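import Literature.Dynamics.SymbolicDynamics.Hochman2025SafePointsPaths
import Literature.Dynamics.SymbolicDynamics.Hochman2025Gluing
import Literature.Dynamics.SymbolicDynamics.Hochman2025Core
import Mathlib.Analysis.SpecialFunctions.Complex.Circle
import Mathlib.Combinatorics.Pigeonhole
import HarnessLib

/-!
# Hochman 2025, §5 (Main construction), part I: scales, the plane model, frames, certificates,
# the obstacle families, Lemmas 5.1–5.2 and Corollary 5.3

First bricks of the formalization of §5 of M. Hochman, *Irreducibility and periodicity in `ℤ²`
symbolic systems* (Discrete Analysis 2025:17). The safe-point machinery of §4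
(`Hochman2025SafePoints*.lean`) is stated for a sequence of scales indexed by ALL of `ℕ`
satisfying `Scales.Good Λ` at every level, while a box `B` of level `n` of a certificate (§5.3)
only carries the finitely many obstacle levels of the family `R_C(B)` (sections of boxes of
levels `< n`, and the two side strips of `B`). This file shows that finitely many levels
satisfying the inequalities of `Scales.Good` among themselves extend to a full good sequence
(`SafePoints.Scales.extendGood`), by the super-exponential recursion
`b_{j+1} = Λ a_j`, `a_{j+1} = max (Λ² a_j) (Λ² a_j² / b_j)` above the prescribed levels; so §4
applies to every such finite list (Prop. 4.1: "`hₙ ≫ wₙ₋₁, hₙ₋₁`, `wₙ ≫ hₙ, wₙ₋₁` for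
`n = 1, …, N`").

Then the plane model of §5.1–5.3 (`Plane`): the plane is `ℂ` with its Euclidean distance,
orientations are the unit complex numbers `orient T k = exp(2πik/T)`, frame coordinates
`coords v c p` rotate back by `v̄`; boxes (almost radial rectangles `[-99r/100, -r/10] × [t, t+h]`
in frame coordinates) and their `S` sections; **Lemma 5.1** (`Plane.lemma_5_1`). The parameters
(`Params`, `Params.Good`: explicit forms of the `≫` relations of §5.2) and the obstacle scales of
a box (`Params.famScales`, good with `Λ = 10`). Frames and certificates as data with
well-formedness predicates (`Frame`, `Frame.WF`, `Cert`, `Cert.WF`, `Cert.Dense`), local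
finiteness of separated families (`Cert.WF.finite_near`). The obstacle family `R_C(B)` of a box
(`Cert.familySet`) — with one deviation from the paper forced by sparsity: a lower box that
qualifies (`2R(i) ∩ B(i) ≠ ∅` for some `i`) contributes the single double section
`DD_R(i₀) = R(i₀) ∪ R(i₀+1)` for its least qualifying index rather than every qualifying
`R(i)` (two adjacent sections may qualify, and then the paper's family is not sparse) —, the
safety of witnesses (`Cert.WitSafe`, for the envelope-hull safe set of §4 in the coordinates of the
frame of the box — origin at its centre, first axis along its orientation —, which makes validity
manifestly translation invariant) and `Cert.Valid`; finiteness of the family; **Lemma 5.2**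
(`Cert.lemma_5_2`: same-class witnesses at different levels are `≥ h/2` apart) and the three
cases of **Corollary 5.3**.

## References

* [Hochman2025] M. Hochman, *Irreducibility and periodicity in `ℤ²` symbolic systems*, Discrete
  Analysis 2025:17, Prop. 4.1 (finitely many levels) and §5.2–5.3. Read via
  `lit read arxiv:2401.02273`.
-/

noncomputable section

open Set
open _root_.SymbolicDynamics.FullShift

namespace Literature.Dynamics.SymbolicDynamics

namespace Hochman2025

namespace SafePoints

namespace Scales

/-- **Finitely many good levels.** The inequalities of `Scales.Good Λ` restricted to the levels
`< m` of two sequences `a, b` (only these levels are prescribed). [cite: Hochman2025, Prop 4.1] -/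
structure GoodBelow (a b : ℕ → ℝ) (Λ : ℝ) (m : ℕ) : Prop where
  ten_le : 10 ≤ Λ
  a_pos : ∀ n, n < m → 0 < a n
  b_pos : ∀ n, n < m → 0 < b n
  flat : ∀ n, n < m → Λ * b n ≤ a n
  sep : ∀ n, n + 1 < m → Λ * a n ≤ b (n + 1)
  slope : ∀ n, n + 1 < m → Λ * (b (n + 1) / a (n + 1)) ≤ b n / a n

/-- The pair `(a_j, b_j)` of the extended sequence: the prescribed values below `m`, then the
recursion `b_{j+1} = Λ a_j`, `a_{j+1} = max (Λ² a_j) (Λ² a_j² / b_j)` (for `m = 0` we start from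
`(Λ, 1)`). [folklore] -/
def extendPair (a b : ℕ → ℝ) (Λ : ℝ) (m : ℕ) : ℕ → ℝ × ℝ
  | 0 => if 0 < m then (a 0, b 0) else (Λ, 1)
  | j + 1 =>
    if j + 1 < m then (a (j + 1), b (j + 1))
    else
      let p := extendPair a b Λ m j
      (max (Λ ^ 2 * p.1) (Λ ^ 2 * p.1 ^ 2 / p.2), Λ * p.1)

/-- The extended scales (as bare sequences). [folklore] -/
def extendA (a b : ℕ → ℝ) (Λ : ℝ) (m : ℕ) (j : ℕ) : ℝ := (extendPair a b Λ m j).1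

/-- The extended scales (as bare sequences). [folklore] -/
def extendB (a b : ℕ → ℝ) (Λ : ℝ) (m : ℕ) (j : ℕ) : ℝ := (extendPair a b Λ m j).2

variable {a b : ℕ → ℝ} {Λ : ℝ} {m : ℕ}

/-- Below `m` the extension is the prescribed sequence. [folklore] -/
theorem extendPair_of_lt {j : ℕ} (hj : j < m) : extendPair a b Λ m j = (a j, b j) := by
  cases j with
  | zero => simp [extendPair, hj]
  | succ j => simp [extendPair, hj]

/-- Above `m` the extension follows the recursion. [folklore] -/
theorem extendPair_succ_of_le {j : ℕ} (hj : m ≤ j + 1) :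
    extendPair a b Λ m (j + 1) =
      (max (Λ ^ 2 * (extendPair a b Λ m j).1) (Λ ^ 2 * (extendPair a b Λ m j).1 ^ 2 / (extendPair a b Λ m j).2),
        Λ * (extendPair a b Λ m j).1) := by
  have : ¬ (j + 1 < m) := by omega
  simp [extendPair, this]

/-- Positivity of the extension. [folklore] -/
theorem extendPair_pos (h : GoodBelow a b Λ m) : ∀ j, 0 < (extendPair a b Λ m j).1 ∧ 0 < (extendPair a b Λ m j).2 := by
  have hΛ : 0 < Λ := lt_of_lt_of_le (by norm_num) h.ten_le
  intro j
  induction j with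
  | zero =>
    by_cases hm : 0 < m
    · rw [extendPair_of_lt hm]; exact ⟨h.a_pos 0 hm, h.b_pos 0 hm⟩
    · simp only [extendPair, hm, if_false]; exact ⟨hΛ, one_pos⟩
  | succ j ih =>
    by_cases hj : j + 1 < m
    · rw [extendPair_of_lt hj]; exact ⟨h.a_pos _ hj, h.b_pos _ hj⟩
    · rw [extendPair_succ_of_le (by omega)]
      refine ⟨lt_max_of_lt_left (by have := ih.1; positivity), mul_pos hΛ ih.1⟩

/-- **The extension is good.** [cite: Hochman2025, Prop 4.1] -/
theorem extend_good (h : GoodBelow a b Λ m) :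
    ∀ j, (Λ * (extendPair a b Λ m j).2 ≤ (extendPair a b Λ m j).1) ∧
      (Λ * (extendPair a b Λ m j).1 ≤ (extendPair a b Λ m (j + 1)).2) ∧
      (Λ * ((extendPair a b Λ m (j + 1)).2 / (extendPair a b Λ m (j + 1)).1) ≤
        (extendPair a b Λ m j).2 / (extendPair a b Λ m j).1) := by
  have hΛ : 0 < Λ := lt_of_lt_of_le (by norm_num) h.ten_le
  have hΛ1 : 1 ≤ Λ := le_trans (by norm_num) h.ten_le
  intro j
  obtain ⟨hpa, hpb⟩ := extendPair_pos h j
  obtain ⟨hqa, hqb⟩ := extendPair_pos h (j + 1)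
  -- flatness at `j`
  have hflat : Λ * (extendPair a b Λ m j).2 ≤ (extendPair a b Λ m j).1 := by
    by_cases hj : j < m
    · rw [extendPair_of_lt hj]; exact h.flat j hj
    · cases j with
      | zero =>
        have : ¬ (0 < m) := by omega
        simp only [extendPair, this, if_false]; linarith
      | succ j =>
        rw [extendPair_succ_of_le (by omega)]
        simp only
        obtain ⟨hp1, -⟩ := extendPair_pos h j
        calc Λ * (Λ * (extendPair a b Λ m j).1) = Λ ^ 2 * (extendPair a b Λ m j).1 := by ring
          _ ≤ _ := le_max_left _ _
  refine ⟨hflat, ?_, ?_⟩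
  · -- separation between `j` and `j+1`
    by_cases hj : j + 1 < m
    · rw [extendPair_of_lt hj, extendPair_of_lt (by omega : j < m)]; exact h.sep j hj
    · rw [extendPair_succ_of_le (by omega)]
  · -- slopes
    by_cases hj : j + 1 < m
    · rw [extendPair_of_lt hj, extendPair_of_lt (by omega : j < m)]; exact h.slope j hj
    · rw [extendPair_succ_of_le (by omega)]
      simp only
      set A := (extendPair a b Λ m j).1 with hA
      set B := (extendPair a b Λ m j).2 with hB
      -- `Λ (ΛA / a') ≤ B / A` where `a' ≥ Λ² A² / B`
      have ha' : Λ ^ 2 * A ^ 2 / B ≤ max (Λ ^ 2 * A) (Λ ^ 2 * A ^ 2 / B) := le_max_right _ _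
      have hpos' : 0 < max (Λ ^ 2 * A) (Λ ^ 2 * A ^ 2 / B) := lt_max_of_lt_left (by positivity)
      have hmul : Λ ^ 2 * A ^ 2 ≤ B * max (Λ ^ 2 * A) (Λ ^ 2 * A ^ 2 / B) := by
        have : B * (Λ ^ 2 * A ^ 2 / B) = Λ ^ 2 * A ^ 2 := by field_simp
        nlinarith [mul_le_mul_of_nonneg_left ha' hpb.le]
      rw [show Λ * (Λ * A / max (Λ ^ 2 * A) (Λ ^ 2 * A ^ 2 / B))
          = (Λ ^ 2 * A) / max (Λ ^ 2 * A) (Λ ^ 2 * A ^ 2 / B) by ring]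
      rw [div_le_div_iff₀ hpos' hpa]
      nlinarith

/-- **The extended scales** as a `Scales` structure satisfying `Good Λ`: the given finitely many
levels, continued super-exponentially. [cite: Hochman2025, Prop 4.1] -/
def extendScales (a b : ℕ → ℝ) (Λ : ℝ) (m : ℕ) (h : GoodBelow a b Λ m) : Scales where
  a := extendA a b Λ m
  b := extendB a b Λ m
  a_pos j := (extendPair_pos h j).1
  b_pos j := (extendPair_pos h j).2

/-- The extended scales agree with the prescribed ones below `m`. [folklore] -/
theorem extendScales_a_of_lt (h : GoodBelow a b Λ m) {j : ℕ} (hj : j < m) :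
    (extendScales a b Λ m h).a j = a j := by
  simp [extendScales, extendA, extendPair_of_lt hj]

/-- The extended scales agree with the prescribed ones below `m`. [folklore] -/
theorem extendScales_b_of_lt (h : GoodBelow a b Λ m) {j : ℕ} (hj : j < m) :
    (extendScales a b Λ m h).b j = b j := by
  simp [extendScales, extendB, extendPair_of_lt hj]

/-- **The extension is good** (`Scales.Good Λ`). [cite: Hochman2025, Prop 4.1] -/
theorem extendScales_good (h : GoodBelow a b Λ m) : (extendScales a b Λ m h).Good Λ where
  ten_le := h.ten_le
  flat j := (extend_good h j).1
  sep j := (extend_good h j).2.1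
  slope j := by
    have := (extend_good h j).2.2
    simpa [Scales.β, extendScales, extendA, extendB] using this

end Scales


end SafePoints

/-! ## §5.1–5.3: the plane model — orientations, frame coordinates, boxes and sections

We model the plane by `ℂ` (Euclidean distance, as in §5.1: "A disk is a closed Euclidean
ball"), orientations by the unit complex numbers `u_k = exp(2πik/T)` (`Θ = {2πk/1000}` in §5.3;
`T` is a parameter here), and the coordinates of a point in the frame of orientation `v` and
origin `c` by `((conj v · (p - c)).re, (conj v · (p - c)).im) ∈ ℝ × ℝ` — the first coordinate
along `v`, the second across. Boxes of orientation `v` in an `r`-disk centred at `c` are the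
rectangles `[-99r/100, -r/10] × [t, t + h]` in these coordinates with `|t|, |t + h| ≤ r/25`
("almost radial": long sides of length `89r/100 ≤ r` parallel to `v`, whose rays in direction
`v` pass within `r/25` of the centre — the paper says `r/100` in §5.1 but needs `r/50` in the
proof of Lemma 5.4; `r/25` leaves room for the angular resolution `2π/T` of the orientations —;
inside the disk; reaching within `r/100·√…` of its boundary); sections are the `S` slices of the
long side counted from the end nearest the centre.
-/

namespace Plane

open Complex

/-- The `k`-th of `T` orientations: the unit complex number `exp(2πik/T)` (§5.3:
"`Θ = {2πk/1000 | 0 ≤ k < 1000}`"). [cite: Hochman2025, §5.3] -/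
def orient (T : ℕ) (k : Fin T) : ℂ := Complex.exp (2 * Real.pi * Complex.I * (k : ℂ) / (T : ℂ))

/-- Orientations are unit complex numbers. [folklore] -/
theorem norm_orient (T : ℕ) (k : Fin T) : ‖orient T k‖ = 1 := by
  unfold orient
  rw [show 2 * (Real.pi : ℂ) * Complex.I * (k : ℂ) / (T : ℂ) = ((2 * Real.pi * k / T : ℝ) : ℂ) * Complex.I by
    push_cast; ring]
  exact Complex.norm_exp_ofReal_mul_I _

/-- **Frame coordinates**: the coordinates of `p` in the orthonormal frame with origin `c` whose
first axis points along the unit vector `v` (rotate back by `v̄` and read off real and imaginary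
parts). [cite: Hochman2025, §5.1 (almost radial rectangles)] -/
def coords (v c p : ℂ) : ℝ × ℝ := ((starRingEnd ℂ v * (p - c)).re, (starRingEnd ℂ v * (p - c)).im)

/-- Frame coordinates of the origin of the frame. [folklore] -/
@[simp] theorem coords_self (v c : ℂ) : coords v c c = (0, 0) := by simp [coords]

/-- Frame coordinates preserve Euclidean distance (for a unit `v`): the complex number with the
coordinates of `p` as real and imaginary parts is `v̄ (p - c)`. [folklore] -/
theorem coords_eq (v c p : ℂ) :
    ((coords v c p).1 : ℂ) + (coords v c p).2 * Complex.I = starRingEnd ℂ v * (p - c) := by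
  simp only [coords]
  exact Complex.re_add_im _

/-- The sup-norm of the frame coordinates is at most the Euclidean distance to the origin
(for a unit `v`). [folklore] -/
theorem abs_coords_le (v c p : ℂ) (hv : ‖v‖ = 1) :
    |(coords v c p).1| ≤ ‖p - c‖ ∧ |(coords v c p).2| ≤ ‖p - c‖ := by
  have hn : ‖starRingEnd ℂ v * (p - c)‖ = ‖p - c‖ := by
    rw [norm_mul, Complex.norm_conj, hv, one_mul]
  constructor
  · calc |(coords v c p).1| = |(starRingEnd ℂ v * (p - c)).re| := rfl
      _ ≤ ‖starRingEnd ℂ v * (p - c)‖ := Complex.abs_re_le_norm _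
      _ = ‖p - c‖ := hn
  · calc |(coords v c p).2| = |(starRingEnd ℂ v * (p - c)).im| := rfl
      _ ≤ ‖starRingEnd ℂ v * (p - c)‖ := Complex.abs_im_le_norm _
      _ = ‖p - c‖ := hn

/-- **A box** (almost radial rectangle of §5.1) of an `r`-disk centred at `c`, with orientation
`v` and transverse offset `t`, of height `h`: in frame coordinates the rectangle
`[-99r/100, -r/10] × [t, t + h]`. [cite: Hochman2025, §5.1 and §5.3] -/
def box (v c : ℂ) (r h t : ℝ) : Set ℂ :=
  {p | -(99 / 100 * r) ≤ (coords v c p).1 ∧ (coords v c p).1 ≤ -(r / 10) ∧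
    t ≤ (coords v c p).2 ∧ (coords v c p).2 ≤ t + h}

/-- The `i`-th of `S` **sections** of a box (§5.3: "divided into 1000 closed rectangular sections
... numbered by increasing distance from the center"): the slice of the long side
`[-r/10 - (i+1)ℓ, -r/10 - iℓ]`, `ℓ = (89r/100)/S`, counted from the end nearest the centre.
[cite: Hochman2025, §5.3] -/
def section_ (v c : ℂ) (r h t : ℝ) (S : ℕ) (i : Fin S) : Set ℂ :=
  {p | -(r / 10) - ((i : ℝ) + 1) * (89 / 100 * r / S) ≤ (coords v c p).1 ∧
    (coords v c p).1 ≤ -(r / 10) - (i : ℝ) * (89 / 100 * r / S) ∧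
    t ≤ (coords v c p).2 ∧ (coords v c p).2 ≤ t + h}

/-- Sections are parts of their box. [folklore] -/
theorem section_subset_box (v c : ℂ) {r h t : ℝ} (hr : 0 ≤ r) {S : ℕ} (hS : 0 < S) (i : Fin S) :
    section_ v c r h t S i ⊆ box v c r h t := by
  rintro p ⟨h1, h2, h3, h4⟩
  have hℓ : 0 ≤ 89 / 100 * r / S := by positivity
  have hi : ((i : ℝ) + 1) * (89 / 100 * r / S) ≤ 89 / 100 * r := by
    have hi' : ((i : ℝ) + 1) ≤ S := by
      have := i.2
      exact_mod_cast this
    calc ((i : ℝ) + 1) * (89 / 100 * r / S) ≤ (S : ℝ) * (89 / 100 * r / S) :=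
          mul_le_mul_of_nonneg_right hi' hℓ
      _ = 89 / 100 * r := by field_simp
  refine ⟨by linarith, ?_, h3, h4⟩
  have : 0 ≤ (i : ℝ) * (89 / 100 * r / S) := by positivity
  linarith

/-- A box lies inside the closed `r`-disk of its frame when its transverse offsets are within
`r/25`. [cite: Hochman2025, §5.1 (almost radial: `R ⊆ D`)] -/
theorem box_subset_closedBall (v c : ℂ) (hv : ‖v‖ = 1) {r h t : ℝ} (hr : 0 ≤ r)
    (ht : |t| ≤ r / 25) (hth : |t + h| ≤ r / 25) :
    box v c r h t ⊆ Metric.closedBall c r := by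
  rintro p ⟨h1, h2, h3, h4⟩
  rw [Metric.mem_closedBall, Complex.dist_eq]
  -- `‖p - c‖² = x² + y²` with `|x| ≤ 0.99 r`, `|y| ≤ r/100`
  have hn : ‖p - c‖ = ‖starRingEnd ℂ v * (p - c)‖ := by
    rw [norm_mul, Complex.norm_conj, hv, one_mul]
  set z := starRingEnd ℂ v * (p - c) with hz
  have hx1 : (coords v c p).1 = z.re := rfl
  have hx2 : (coords v c p).2 = z.im := rfl
  rw [hx1] at h1 h2
  rw [hx2] at h3 h4
  have hx : |z.re| ≤ 99 / 100 * r := by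
    rw [abs_le]; constructor <;> linarith
  have hy : |z.im| ≤ r / 25 := by
    rw [abs_le] at ht hth ⊢
    constructor <;> linarith [ht.1, hth.2]
  rw [hn]
  have hsq : ‖z‖ ^ 2 = z.re ^ 2 + z.im ^ 2 := by
    rw [Complex.sq_norm, Complex.normSq_apply]; ring
  have hx2 : z.re ^ 2 ≤ (99 / 100 * r) ^ 2 := by
    have := sq_le_sq' (abs_le.mp hx).1 (abs_le.mp hx).2; nlinarith [sq_abs z.re]
  have hy2 : z.im ^ 2 ≤ (r / 25) ^ 2 := by
    have := sq_le_sq' (abs_le.mp hy).1 (abs_le.mp hy).2; nlinarith [sq_abs z.im]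
  nlinarith [norm_nonneg z]


/-- Reconstructing a point from its frame coordinates (unit `v`): `p = c + v · (x + iy)`.
[folklore] -/
theorem eq_add_mul_coords (v c p : ℂ) (hv : ‖v‖ = 1) :
    p = c + v * (((coords v c p).1 : ℂ) + (coords v c p).2 * Complex.I) := by
  rw [coords_eq, ← mul_assoc, Complex.mul_conj, Complex.normSq_eq_norm_sq, hv]
  push_cast
  ring

/-- **Lemma 5.1** (same level, same orientation, far-apart frames ⇒ corresponding sections are
far apart): if two `r`-frames have centres at (Euclidean) distance `≥ r/2` and `B, B'` are boxes
of the same orientation `v` in them (transverse offsets within `r/25`, at least `10` sections),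
then for every index `i` the `i`-th sections of `B` and `B'` are at distance `> r/4`:
`p - q = (c - c') + v · ((x_p - x_q) + i (y_p - y_q))` with `|x_p - x_q| ≤ ℓ = 0.089 r` and
`|y_p - y_q| ≤ 2r/25`. [cite: Hochman2025, Lemma 5.1] -/
theorem lemma_5_1 (v c c' : ℂ) (hv : ‖v‖ = 1) {r h h' t t' : ℝ} (hr : 0 < r) {S : ℕ} (hS : 10 ≤ S)
    (hcc' : r / 2 ≤ ‖c - c'‖) (ht : |t| ≤ r / 25) (hth : |t + h| ≤ r / 25)
    (ht' : |t'| ≤ r / 25) (hth' : |t' + h'| ≤ r / 25) (i : Fin S) :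
    ∀ p ∈ section_ v c r h t S i, ∀ q ∈ section_ v c' r h' t' S i, r / 4 < ‖p - q‖ := by
  intro p hp q hq
  obtain ⟨hp1, hp2, hp3, hp4⟩ := hp
  obtain ⟨hq1, hq2, hq3, hq4⟩ := hq
  set zp : ℂ := ((coords v c p).1 : ℂ) + (coords v c p).2 * Complex.I with hzp
  set zq : ℂ := ((coords v c' q).1 : ℂ) + (coords v c' q).2 * Complex.I with hzq
  have hpq : p - q = (c - c') + v * (zp - zq) := by
    rw [eq_add_mul_coords v c p hv, eq_add_mul_coords v c' q hv]
    simp only [hzp, hzq]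
    ring
  -- the frame-coordinate differences are small
  have hS' : (0 : ℝ) < S := by exact_mod_cast (lt_of_lt_of_le (by norm_num) hS)
  have hℓ : 89 / 100 * r / S ≤ 89 / 1000 * r := by
    rw [div_le_iff₀ hS']
    have : (10 : ℝ) ≤ S := by exact_mod_cast hS
    nlinarith
  have hx : |(coords v c p).1 - (coords v c' q).1| ≤ 89 / 100 * r / S := by
    rw [abs_le]; constructor <;> nlinarith
  have hy : |(coords v c p).2 - (coords v c' q).2| ≤ 2 * r / 25 := by
    rw [abs_le] at ht hth ht' hth' ⊢
    constructor <;> linarith [ht.1, hth.2, ht'.1, hth'.2]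
  have hz : ‖zp - zq‖ ≤ 89 / 1000 * r + 2 * r / 25 := by
    have hre : (zp - zq).re = (coords v c p).1 - (coords v c' q).1 := by
      simp [hzp, hzq]
    have him : (zp - zq).im = (coords v c p).2 - (coords v c' q).2 := by
      simp [hzp, hzq]
    have := Complex.norm_le_abs_re_add_abs_im (zp - zq)
    rw [hre, him] at this
    linarith
  have hvz : ‖v * (zp - zq)‖ ≤ 89 / 1000 * r + 2 * r / 25 := by
    rw [norm_mul, hv, one_mul]; exact hz
  -- reverse triangle inequality
  have htri : ‖c - c'‖ - ‖v * (zp - zq)‖ ≤ ‖p - q‖ := by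
    rw [hpq]
    have := norm_sub_norm_le (c - c') (-(v * (zp - zq)))
    rw [norm_neg, sub_neg_eq_add] at this
    linarith [abs_sub_abs_le_abs_sub ‖c - c'‖ ‖v * (zp - zq)‖, norm_add_le (c - c') (v * (zp - zq)),
      norm_sub_le (c - c' + v * (zp - zq)) (v * (zp - zq))]
  nlinarith

end Plane

/-! ## §5.2: parameters, and the obstacle scales of a box -/

/-- **The parameters of the construction** (§5.2): the number `T` of orientations and `S` of
sections (both `1000` in the paper), the radii `r n` of level-`n` frames (`rₙ = (10/9) wₙ`) and
the heights `h n` of level-`n` boxes; the other quantities are derived: box length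
`wB n = 89 rₙ / 100`, section length `ℓ n = wB n / S`, number of buckets
`buckets n = n² T S` and number of boxes/coins per frame `N n = kₙ 2^{kₙ+1}` (enough coins for
`CoinsAndBuckets.not_isOriented_of_big_bucket`; the paper's `21·10⁶ n²` is too small for
Prop. 3.1 to apply). Levels `n ≥ 1` are meaningful (level `n` serves the modulus `n`).
[cite: Hochman2025, §5.2] -/
structure Params where
  /-- number of orientations (`|Θ|`) -/
  T : ℕ
  /-- number of sections of a box (`|Σ|`) -/
  S : ℕ
  /-- radius of level-`n` frames -/
  r : ℕ → ℝ
  /-- height of level-`n` boxes -/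
  h : ℕ → ℝ
  r_pos : ∀ n, 0 < r n
  h_pos : ∀ n, 0 < h n

namespace Params

/-- Length of level-`n` boxes (`wₙ = 9 rₙ / 10` in the paper; we keep the far end `r/100`
inside the disk, whence `89/100`). [cite: Hochman2025, §5.2] -/
def wB (P : Params) (n : ℕ) : ℝ := 89 / 100 * P.r n

/-- Length of a section of a level-`n` box. [cite: Hochman2025, §5.3] -/
def ℓ (P : Params) (n : ℕ) : ℝ := P.wB n / P.S

/-- Number of buckets of the coin-and-bucket configuration of a level-`n` frame:
`n² · |Θ| · |Σ|`. [cite: Hochman2025, §5.6] -/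
def buckets (P : Params) (n : ℕ) : ℕ := n ^ 2 * P.T * P.S

/-- Number of boxes (= witnesses = coins) of a level-`n` frame. [cite: Hochman2025, §5.2–5.3] -/
def N (P : Params) (n : ℕ) : ℕ := P.buckets n * 2 ^ (P.buckets n + 1)

/-- `wB` is positive. [folklore] -/
theorem wB_pos (P : Params) (n : ℕ) : 0 < P.wB n := by unfold wB; have := P.r_pos n; positivity

/-- **Standing inequalities between the parameters** (§5.2: "`h₁/w₁ ≪ 1`, `hₙ₊₁ ≫ wₙ, hₙ, n`,
`wₙ₊₁ ≫ hₙ₊₁, wₙ, n`", made explicit with the constants this formalization needs).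
[cite: Hochman2025, §5.2] -/
structure Good (P : Params) : Prop where
  T_le : 1000 ≤ P.T
  S_le : 1000 ≤ P.S
  /-- sections are long: `5 hₙ ≤ ℓₙ` -/
  h_le_ℓ : ∀ n, 5 * P.h n ≤ P.ℓ n
  /-- heights dominate lower radii: `2000 rₙ ≤ hₙ₊₁` -/
  r_le_h : ∀ n, 2000 * P.r n ≤ P.h (n + 1)
  /-- slopes of sections decrease tenfold: `10 hₙ₊₁ ℓₙ ≤ hₙ ℓₙ₊₁` -/
  slope : ∀ n, 10 * (P.h (n + 1) * P.ℓ n) ≤ P.h n * P.ℓ (n + 1)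
  /-- the boxes of a frame fit in the radial band: `101 Nₙ hₙ ≤ rₙ / 100` -/
  boxes_fit : ∀ n, 101 * (P.N n : ℝ) * P.h n ≤ P.r n / 100
  /-- a stack of `Nₙ + S + 1` boxes fits across a transverse window of width `rₙ / (100 T)`
  (room for Lemma 5.4 / Step C of §6.3, where new boxes are built across a gap and at most `S`
  of them are discarded as threatening) -/
  stack_fit : ∀ n, 101 * ((P.N n : ℝ) + P.S + 1) * P.h n ≤ P.r n / (100 * P.T)
  /-- the lattice is fine at the first level: `8 ≤ h₁` (so that distinct same-class witnesses,
  which are `≥ h₁/2` apart by Cor. 5.3, occupy distinct lattice sites) -/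
  h_one : 8 ≤ P.h 1

variable {P : Params}

/-- `ℓ` is positive. [folklore] -/
theorem ℓ_pos (hP : P.Good) (n : ℕ) : 0 < P.ℓ n := by
  unfold ℓ
  have := P.wB_pos n
  have : (0 : ℝ) < P.S := by exact_mod_cast lt_of_lt_of_le (by norm_num) hP.S_le
  positivity

/-- `ℓ ≤ wB`. [folklore] -/
theorem ℓ_le_wB (hP : P.Good) (n : ℕ) : P.ℓ n ≤ P.wB n := by
  unfold ℓ
  have hS : (1 : ℝ) ≤ P.S := by exact_mod_cast le_trans (by norm_num) hP.S_le
  exact div_le_self (P.wB_pos n).le hS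

/-- The prescribed obstacle scales of a level-`n` box (`n ≥ 1`): index `j < n - 1` carries the
double sections of level `j + 1` (width `2 ℓ_{j+1}`, height `h_{j+1}`), index `n - 1` the two
side strips of the box (width `wB n`, height `h n / 100`); as `Scales` data `a = 2 w`, `b = 2 h`
of the associated diamonds `◇(2R)`. [cite: Hochman2025, §5.3 (the family `R_C(B)`)] -/
def famA (P : Params) (n j : ℕ) : ℝ := if j + 1 < n then 2 * (2 * P.ℓ (j + 1)) else 2 * P.wB n

/-- See `famA`. [cite: Hochman2025, §5.3] -/
def famB (P : Params) (n j : ℕ) : ℝ := if j + 1 < n then 2 * P.h (j + 1) else 2 * (P.h n / 100)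

/-- **The obstacle scales of a box are good below its level** (`Λ = 10`), so they extend to a
good sequence of scales and §4 applies to the family `R_C(B)`. [cite: Hochman2025, Prop 4.1 and §5.3] -/
theorem famGoodBelow (hP : P.Good) (n : ℕ) :
    SafePoints.Scales.GoodBelow (P.famA n) (P.famB n) 10 n := by
  have hℓ := ℓ_pos hP
  refine ⟨le_rfl, ?_, ?_, ?_, ?_, ?_⟩
  · intro j _
    unfold famA
    split_ifs
    · have := hℓ (j + 1); positivity
    · have := P.wB_pos n; positivity
  · intro j _
    unfold famB
    split_ifs
    · have := P.h_pos (j + 1); positivity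
    · have := P.h_pos n; positivity
  · -- flatness
    intro j hj
    unfold famA famB
    by_cases h : j + 1 < n
    · simp only [h, if_true]
      have := hP.h_le_ℓ (j + 1)
      linarith
    · simp only [h, if_false]
      have h1 := hP.h_le_ℓ n
      have h2 := ℓ_le_wB hP n
      linarith [P.h_pos n]
  · -- separation of consecutive levels
    intro j hj
    unfold famA famB
    have h : j + 1 < n := by omega
    simp only [h, if_true]
    by_cases h' : j + 1 + 1 < n
    · simp only [h', if_true]
      have h1 := hP.r_le_h (j + 1)
      have h2 := ℓ_le_wB hP (j + 1)
      unfold wB at h2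
      linarith [P.r_pos (j + 1)]
    · simp only [h', if_false]
      have heq : n = j + 1 + 1 := by omega
      have h1 := hP.r_le_h (j + 1)
      rw [← heq] at h1
      have h2 := ℓ_le_wB hP (j + 1)
      unfold wB at h2
      linarith [P.r_pos (j + 1)]
  · -- slopes
    intro j hj
    unfold famA famB
    have h : j + 1 < n := by omega
    simp only [h, if_true]
    have hℓ1 := hℓ (j + 1)
    have hh1 := P.h_pos (j + 1)
    by_cases h' : j + 1 + 1 < n
    · simp only [h', if_true]
      have hs := hP.slope (j + 1)
      have hℓ2 := hℓ (j + 1 + 1)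
      have hh2 := P.h_pos (j + 1 + 1)
      rw [← mul_div_assoc, div_le_div_iff₀ (by positivity) (by positivity)]
      nlinarith
    · simp only [h', if_false]
      have heq : n = j + 1 + 1 := by omega
      have hs := hP.slope (j + 1)
      rw [← heq] at hs
      have hw := P.wB_pos n
      have hℓn := hℓ n
      have hℓw : P.ℓ n ≤ P.wB n := ℓ_le_wB hP n
      have hhn := P.h_pos n
      rw [← mul_div_assoc, div_le_div_iff₀ (by positivity) (by positivity)]
      nlinarith [mul_le_mul_of_nonneg_left hℓw hh1.le]

/-- **The obstacle scales of a level-`n` box**, extended to a good sequence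
(`Scales.extendScales`). [cite: Hochman2025, §5.3 and Prop 4.1] -/
def famScales (P : Params) (hP : P.Good) (n : ℕ) : SafePoints.Scales :=
  SafePoints.Scales.extendScales (P.famA n) (P.famB n) 10 n (famGoodBelow hP n)

/-- The obstacle scales of a box are good (`Λ = 10`). [cite: Hochman2025, Prop 4.1] -/
theorem famScales_good (hP : P.Good) (n : ℕ) : (P.famScales hP n).Good 10 :=
  SafePoints.Scales.extendScales_good _

end Params



namespace Params

/-! ### A model of the parameter inequalities (non-vacuity of `Params.Good`) -/

/-- The multiplier `Mₙ = 10ⁿ (10⁷ T (Nₙ + S + 1000) + 6 S + 1)` of the standard parameters. [folklore] -/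
def stdM (T S : ℕ) (n : ℕ) : ℝ :=
  10 ^ n * (10 ^ 7 * (T : ℝ) * ((n ^ 2 * T * S * 2 ^ (n ^ 2 * T * S + 1) : ℕ) + S + 1000) + 6 * S + 1)

/-- The heights of the standard parameters: `h₀ = 8`, `hₙ₊₁ = 2000 Mₙ hₙ`. [folklore] -/
def stdH (T S : ℕ) : ℕ → ℝ
  | 0 => 8
  | n + 1 => 2000 * stdM T S n * stdH T S n

/-- **Standard parameters** with `T` orientations and `S` sections: `rₙ = Mₙ hₙ`. [folklore] -/
def std (T S : ℕ) : Params where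
  T := T
  S := S
  r n := stdM T S n * stdH T S n
  h := stdH T S
  r_pos n := by
    have hM : ∀ m, 0 < stdM T S m := fun m => by unfold stdM; positivity
    have hH : ∀ m, 0 < stdH T S m := by
      intro m; induction m with
      | zero => simp [stdH]
      | succ m ih => simp only [stdH]; have := hM m; positivity
    exact mul_pos (hM n) (hH n)
  h_pos n := by
    have hM : ∀ m, 0 < stdM T S m := fun m => by unfold stdM; positivity
    induction n with
    | zero => simp [stdH]
    | succ m ih => simp only [stdH]; have := hM m; positivity

/-- The multiplier dominates: `Mₙ ≥ 10⁷ T (Nₙ + S + 1000)` and `Mₙ ≥ 6 S`. [folklore] -/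
theorem stdM_ge (T S n : ℕ) :
    10 ^ 7 * (T : ℝ) * (((std T S).N n : ℝ) + S + 1000) ≤ stdM T S n ∧ 6 * (S : ℝ) ≤ stdM T S n := by
  have hN : ((std T S).N n : ℝ) = ((n ^ 2 * T * S * 2 ^ (n ^ 2 * T * S + 1) : ℕ) : ℝ) := by
    simp [N, buckets, std]
  have h10 : (1 : ℝ) ≤ 10 ^ n := one_le_pow₀ (by norm_num)
  have hA : 0 ≤ 10 ^ 7 * (T : ℝ) * (((n ^ 2 * T * S * 2 ^ (n ^ 2 * T * S + 1) : ℕ) : ℝ) + S + 1000) := by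
    positivity
  have hB : (0 : ℝ) ≤ 6 * S := by positivity
  unfold stdM
  rw [hN]
  constructor <;> nlinarith

/-- The multiplier grows at least tenfold per level. [folklore] -/
theorem stdM_succ_ge (T S n : ℕ) : 10 * stdM T S n ≤ stdM T S (n + 1) := by
  unfold stdM
  have hmono : (((n ^ 2 * T * S * 2 ^ (n ^ 2 * T * S + 1) : ℕ) : ℝ)) ≤
      (((n + 1) ^ 2 * T * S * 2 ^ ((n + 1) ^ 2 * T * S + 1) : ℕ) : ℝ) := by
    have h1 : n ^ 2 * T * S ≤ (n + 1) ^ 2 * T * S := by gcongr; omega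
    exact_mod_cast Nat.mul_le_mul h1 (Nat.pow_le_pow_right (by norm_num) (by omega))
  have hpos : (0 : ℝ) ≤ 10 ^ n := by positivity
  set X : ℕ → ℝ := fun m => 10 ^ 7 * (T : ℝ) * (((m ^ 2 * T * S * 2 ^ (m ^ 2 * T * S + 1) : ℕ) : ℝ) + S + 1000)
    + 6 * S + 1 with hX
  have hXmono : X n ≤ X (n + 1) := by
    simp only [hX]
    nlinarith [mul_le_mul_of_nonneg_left hmono (by positivity : (0 : ℝ) ≤ 10 ^ 7 * (T : ℝ))]
  calc 10 * (10 ^ n * X n) = 10 ^ n * 10 * X n := by ring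
    _ ≤ 10 ^ n * 10 * X (n + 1) := mul_le_mul_of_nonneg_left hXmono (by positivity)
    _ = 10 ^ (n + 1) * X (n + 1) := by rw [pow_succ]

/-- **The standard parameters are good** (for `T, S ≥ 1000`): the inequalities of `Params.Good`
are jointly satisfiable. [folklore] -/
theorem std_good {T S : ℕ} (hT : 1000 ≤ T) (hS : 1000 ≤ S) : (std T S).Good := by
  have hM : ∀ m, 0 < stdM T S m := fun m => by unfold stdM; positivity
  have hH : ∀ m, 0 < stdH T S m := (std T S).h_pos
  have hr : ∀ n, (std T S).r n = stdM T S n * stdH T S n := fun n => rfl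
  have hh : ∀ n, (std T S).h n = stdH T S n := fun n => rfl
  have hhs : ∀ n, stdH T S (n + 1) = 2000 * stdM T S n * stdH T S n := fun n => rfl
  have hℓ : ∀ n, (std T S).ℓ n = 89 / 100 * (stdM T S n * stdH T S n) / S := fun n => rfl
  have hS' : (0 : ℝ) < S := by exact_mod_cast lt_of_lt_of_le (by norm_num) hS
  have hT' : (1000 : ℝ) ≤ T := by exact_mod_cast hT
  refine ⟨hT, hS, ?_, ?_, ?_, ?_, ?_, ?_⟩
  · intro n
    rw [hℓ, hh, le_div_iff₀ hS']
    have := (stdM_ge T S n).2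
    nlinarith [hH n]
  · intro n
    rw [hr, hh, hhs]
    exact le_of_eq (by ring)
  · intro n
    rw [hh, hh, hℓ, hℓ, hhs]
    have h1 := stdM_succ_ge T S n
    -- `10 · (2000 M h) · (0.89 M h / S) ≤ h · (0.89 M' (2000 M h) / S)` iff `10 M ≤ M'`
    have hc : 0 ≤ 1780 * stdM T S n * stdH T S n ^ 2 := by have := hM n; positivity
    have key : 10 * (2000 * stdM T S n * stdH T S n * (89 / 100 * (stdM T S n * stdH T S n))) ≤
        stdH T S n * (89 / 100 * (stdM T S (n + 1) * (2000 * stdM T S n * stdH T S n))) := by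
      nlinarith [mul_le_mul_of_nonneg_right h1 hc]
    calc 10 * (2000 * stdM T S n * stdH T S n * (89 / 100 * (stdM T S n * stdH T S n) / ↑S))
        = 10 * (2000 * stdM T S n * stdH T S n * (89 / 100 * (stdM T S n * stdH T S n))) / S := by
          ring
      _ ≤ stdH T S n * (89 / 100 * (stdM T S (n + 1) * (2000 * stdM T S n * stdH T S n))) / S :=
          div_le_div_of_nonneg_right key hS'.le
      _ = _ := by ring
  · intro n
    rw [hr, hh]
    have := (stdM_ge T S n).1
    have hN : (0 : ℝ) ≤ (std T S).N n := by positivity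
    have hS0 : (0 : ℝ) ≤ S := by positivity
    have hM' : 10100 * ((std T S).N n : ℝ) ≤ stdM T S n := by nlinarith
    have h3 := hH n
    nlinarith [mul_le_mul_of_nonneg_right hM' h3.le]
  · intro n
    rw [hr, hh, le_div_iff₀ (by positivity)]
    have := (stdM_ge T S n).1
    have hN : (0 : ℝ) ≤ (std T S).N n := by positivity
    have hTstd : ((std T S).T : ℝ) = T := rfl
    have hSstd : ((std T S).S : ℝ) = S := rfl
    rw [hTstd, hSstd]
    have hS0 : (0 : ℝ) ≤ S := by positivity
    have hM' : 10100 * (T : ℝ) * (((std T S).N n : ℝ) + S + 1) ≤ stdM T S n := by nlinarith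
    have h3 := hH n
    nlinarith [mul_le_mul_of_nonneg_right hM' h3.le]
  · rw [hh, hhs]
    simp only [stdH]
    have := hM 0
    have h1 : (1 : ℝ) ≤ stdM T S 0 := by
      have := (stdM_ge T S 0).2
      have : (1000 : ℝ) ≤ S := by exact_mod_cast hS
      linarith
    nlinarith

end Params

/-! ## §5.3: frames and certificates (data and well-formedness) -/

/-- A separated subset of a bounded region of the plane is finite (frames of one level have
`r/2`-separated centres, so only finitely many are near any given box). [folklore] -/
theorem Plane.finite_of_separated {A : Set ℂ} {δ : ℝ} (hδ : 0 < δ)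
    (hsep : A.Pairwise fun x y => δ ≤ dist x y) {p : ℂ} {L : ℝ}
    (hA : A ⊆ Metric.closedBall p L) : A.Finite := by
  have htb : TotallyBounded (Metric.closedBall p L) := (isCompact_closedBall p L).totallyBounded
  obtain ⟨t, htf, hcover⟩ := Metric.totallyBounded_iff.1 htb (δ / 2) (by positivity)
  have hex : ∀ a ∈ A, ∃ y ∈ t, a ∈ Metric.ball y (δ / 2) := by
    intro a ha
    have := hcover (hA ha)
    simpa only [Set.mem_iUnion, exists_prop] using this
  choose! f hf using hex
  have himg : f '' A ⊆ t := by rintro _ ⟨a, ha, rfl⟩; exact (hf a ha).1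
  refine Set.Finite.of_finite_image (f := f) (htf.subset himg) ?_
  · intro a ha a' ha' hfa
    by_contra hne
    have h1 := (hf a ha).2
    have h2 := (hf a' ha').2
    rw [Metric.mem_ball] at h1 h2
    rw [hfa] at h1
    have := hsep ha ha' hne
    have := dist_triangle_right a a' (f a')
    linarith

variable (P : Params)

/-- **A frame of level `n`** (data; §5.3): its centre, its orientation `θ ∈ Θ` (an index
`k < T`), and for each of its `N n` boxes the transverse offset of the box, the witness of the
box and the index of the section holding the witness. [cite: Hochman2025, §5.3] -/
structure Frame (n : ℕ) where
  /-- centre `c(F)` -/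
  c : ℂ
  /-- orientation index (`θ(F) = 2πk/T`) -/
  k : Fin P.T
  /-- transverse offsets of the boxes (in frame coordinates) -/
  t : Fin (P.N n) → ℝ
  /-- the witnesses `w_C(B)` -/
  w : Fin (P.N n) → ℂ
  /-- the section index `σ_B(w_C(B))` of each witness -/
  σ : Fin (P.N n) → Fin P.S

variable {P}

namespace Frame

variable {n : ℕ} (F : Frame P n)

/-- The orientation (a unit complex number). [cite: Hochman2025, §5.3] -/
def v : ℂ := Plane.orient P.T F.k

/-- The `j`-th box. [cite: Hochman2025, §5.3] -/
def box (j : Fin (P.N n)) : Set ℂ := Plane.box F.v F.c (P.r n) (P.h n) (F.t j)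

/-- The `i`-th section of the `j`-th box. [cite: Hochman2025, §5.3] -/
def sect (j : Fin (P.N n)) (i : Fin P.S) : Set ℂ := Plane.section_ F.v F.c (P.r n) (P.h n) (F.t j) P.S i

/-- The disk of the frame. [cite: Hochman2025, §5.1] -/
def disk : Set ℂ := Metric.closedBall F.c (P.r n)

/-- **Well-formed frame**: boxes inside the radial band (`|t|, |t + h| ≤ r/25`), pairwise
`100 h` apart (offsets differ by `≥ 101 h`), each witness in the designated section of its box.
[cite: Hochman2025, §5.3 (1)–(2)] -/
structure WF : Prop where
  band : ∀ j, |F.t j| ≤ P.r n / 25 ∧ |F.t j + P.h n| ≤ P.r n / 25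
  apart : ∀ j j', j ≠ j' → 101 * P.h n ≤ |F.t j - F.t j'|
  wit : ∀ j, F.w j ∈ F.sect j (F.σ j)

/-- The orientation is a unit vector. [folklore] -/
theorem norm_v : ‖F.v‖ = 1 := Plane.norm_orient P.T F.k

/-- Witnesses of a well-formed frame lie in their boxes. [cite: Hochman2025, §5.3 (2)] -/
theorem WF.w_mem_box (hF : F.WF) (hS : 0 < P.S) (j : Fin (P.N n)) : F.w j ∈ F.box j :=
  Plane.section_subset_box F.v F.c (P.r_pos n).le hS (F.σ j) (hF.wit j)

/-- Boxes of a well-formed frame lie in its disk. [cite: Hochman2025, §5.1] -/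
theorem WF.box_subset_disk (hF : F.WF) (j : Fin (P.N n)) : F.box j ⊆ F.disk :=
  Plane.box_subset_closedBall F.v F.c F.norm_v (P.r_pos n).le (hF.band j).1 (hF.band j).2

end Frame

variable (P) in
/-- **A certificate** (data; Def. 5.6 of the paper calls the whole structure `C = (Cₙ)` with
`Cₙ` the set of `n`-frames): for each level the set of its frames. [cite: Hochman2025, §5.3] -/
structure Cert where
  /-- the level-`n` frames -/
  frames : (n : ℕ) → Set (Frame P n)

namespace Cert

variable (C : Cert P)

/-- **Structural well-formedness of a certificate** (everything in §5.3 except the safety of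
witnesses, which needs the obstacle families defined below): frames well formed and centres of
each level `r n / 2`-separated ("`C_n` is `r_n/2`-separated", i.e. distinct frames have centres
at distance `≥ r_n / 2`). [cite: Hochman2025, §5.3] -/
structure WF : Prop where
  frame : ∀ n, ∀ F ∈ C.frames n, F.WF
  sep : ∀ n, ∀ F ∈ C.frames n, ∀ F' ∈ C.frames n, F ≠ F' → P.r n / 2 ≤ ‖F.c - F'.c‖

/-- **Dense levels** (Def. 5.6: "level `n` of `C` is dense if the set of centers of `C_n` is
`10 r_n`-dense in `ℝ²`"). [cite: Hochman2025, Def 5.6] -/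
def Dense (C' : Cert P) : Prop := ∀ n, 1 ≤ n → ∀ p : ℂ, ∃ F ∈ C'.frames n, ‖p - F.c‖ ≤ 10 * P.r n

variable {C}

/-- Distinct frames of one level of a well-formed certificate have distinct centres. [folklore] -/
theorem WF.c_injOn (hC : C.WF) (n : ℕ) : Set.InjOn Frame.c (C.frames n) := by
  intro F hF F' hF' h
  by_contra hne
  have := hC.sep n F hF F' hF' hne
  rw [h, sub_self, norm_zero] at this
  linarith [P.r_pos n]

/-- **Local finiteness**: only finitely many frames of a level have their centre in a given
disk. [cite: Hochman2025, §5.3 (`C_n` is `r_n/2`-separated)] -/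
theorem WF.finite_near (hC : C.WF) (n : ℕ) (p : ℂ) (L : ℝ) :
    {F ∈ C.frames n | ‖F.c - p‖ ≤ L}.Finite := by
  have hsub : {F ∈ C.frames n | ‖F.c - p‖ ≤ L} ⊆ C.frames n := fun F hF => hF.1
  apply Set.Finite.of_finite_image _ ((hC.c_injOn n).mono hsub)
  refine Plane.finite_of_separated (half_pos (P.r_pos n)) ?_ (p := p) (L := L) ?_
  · rintro _ ⟨F, hF, rfl⟩ _ ⟨F', hF', rfl⟩ hne
    rw [Complex.dist_eq]
    exact hC.sep n F hF.1 F' hF'.1 fun h => hne (by rw [h])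
  · rintro _ ⟨F, hF, rfl⟩
    rw [Metric.mem_closedBall, Complex.dist_eq]
    exact hF.2

end Cert


namespace Plane

/-- Frame coordinates are affine in the origin: `coords v c p = coords v 0 p - coords v 0 c`.
[folklore] -/
theorem coords_eq_sub (v c p : ℂ) : coords v c p = coords v 0 p - coords v 0 c := by
  simp only [coords, sub_zero, Prod.mk_sub_mk, ← Complex.sub_re, ← Complex.sub_im, ← mul_sub]

/-- Differences of frame coordinates are bounded by the Euclidean distance (unit `v`).
[folklore] -/
theorem abs_coords_sub_le (v c p q : ℂ) (hv : ‖v‖ = 1) :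
    |(coords v c p).1 - (coords v c q).1| ≤ ‖p - q‖ ∧ |(coords v c p).2 - (coords v c q).2| ≤ ‖p - q‖ := by
  have h := abs_coords_le v q p hv
  have e1 : (coords v c p).1 - (coords v c q).1 = (coords v q p).1 := by
    simp only [coords, ← Complex.sub_re, ← mul_sub]; ring_nf
  have e2 : (coords v c p).2 - (coords v c q).2 = (coords v q p).2 := by
    simp only [coords, ← Complex.sub_im, ← mul_sub]; ring_nf
  rw [e1, e2]
  exact h

/-- The doubled `i`-th section `2·B(i)` (same centre, dimensions `2ℓ × 2h`; §4.1 "`cE`").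
[cite: Hochman2025, §4.1 and §5.3] -/
def section2 (v c : ℂ) (r h t : ℝ) (S : ℕ) (i : Fin S) : Set ℂ :=
  {p | -(r / 10) - ((i : ℝ) + 1) * (89 / 100 * r / S) - (89 / 100 * r / S) / 2 ≤ (coords v c p).1 ∧
    (coords v c p).1 ≤ -(r / 10) - (i : ℝ) * (89 / 100 * r / S) + (89 / 100 * r / S) / 2 ∧
    t - h / 2 ≤ (coords v c p).2 ∧ (coords v c p).2 ≤ t + h + h / 2}

/-- **A point outside `2·B(i)` is at distance `≥ h/2` from every point of `B(i)`** (when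
`h ≤ ℓ`). [cite: Hochman2025, Lemma 5.2 (proof)] -/
theorem dist_ge_of_not_mem_section2 (v c : ℂ) (hv : ‖v‖ = 1) {r h t : ℝ} {S : ℕ}
    (hhℓ : h ≤ 89 / 100 * r / S) (i : Fin S) {p q : ℂ}
    (hp : p ∈ section_ v c r h t S i) (hq : q ∉ section2 v c r h t S i) : h / 2 ≤ ‖p - q‖ := by
  obtain ⟨hp1, hp2, hp3, hp4⟩ := hp
  obtain ⟨hx, hy⟩ := abs_coords_sub_le v c p q hv
  rw [abs_le] at hx hy
  simp only [section2, Set.mem_setOf_eq, not_and_or, not_le] at hq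
  rcases hq with hq | hq | hq | hq <;> linarith

end Plane

namespace Frame

variable {n : ℕ} (F : Frame P n)

/-- The doubled `i`-th section of the `j`-th box. [cite: Hochman2025, §5.3] -/
def sect2 (j : Fin (P.N n)) (i : Fin P.S) : Set ℂ :=
  Plane.section2 F.v F.c (P.r n) (P.h n) (F.t j) P.S i

/-- The coordinates of the frame (`coords v c`: origin at the centre, first axis along the
orientation); the obstacle family of a box and the safety of its witness are expressed in these
coordinates, which makes them manifestly invariant under translation of the whole certificate.
[folklore] -/
def φ (p : ℂ) : ℝ × ℝ := Plane.coords F.v F.c p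

/-- The centre has coordinates `(0, 0)`. [folklore] -/
@[simp] theorem φ_c : F.φ F.c = (0, 0) := Plane.coords_self F.v F.c

end Frame

/-! ### The obstacle family `R_C(B)` of a box (§5.3 (3)), with the sparsity fix

For a box `B = (F, j)` of level `n` the family consists of the two side strips of `B`
(`wB n × h n / 100` rectangles along its long sides, outside `B`) and, for every box
`R = (F', j')` of a level `1 ≤ k < n` with the same orientation index such that
`2R(i) ∩ B(i) ≠ ∅` for some section index `i`, of ONE rectangle: the double section
`DD_R(i₀) = R(i₀) ∪ R(i₀ + 1)` for the least such `i₀` (the paper takes every such `R(i)`,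
but two adjacent sections of the same `R` may qualify, and then the paper's family is not
sparse; `2·DD ⊇ 2R(i₀) ∪ 2R(i₀+1)` keeps Lemma 5.2 intact). Members are recorded as `Diamond`s
(centre in the coordinates `F.φ` of the upper frame, level index `k - 1`, resp. `n - 1` for the
strips) for the scales `P.famScales hP n`. -/

namespace Cert

variable (C : Cert P)

/-- Box `(F', j')` (level `k`) qualifies at index `i` for box `(F, j)` (level `n`):
`2R(i) ∩ B(i) ≠ ∅`. [cite: Hochman2025, §5.3 (3)] -/
def Qual {n k : ℕ} (F : Frame P n) (j : Fin (P.N n)) (F' : Frame P k) (j' : Fin (P.N k))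
    (i : Fin P.S) : Prop :=
  (F'.sect2 j' i ∩ F.sect j i).Nonempty

open Classical in
/-- The least qualifying index, if any. [cite: Hochman2025, §5.3 (3)] -/
def qualIdx {n k : ℕ} (F : Frame P n) (j : Fin (P.N n)) (F' : Frame P k) (j' : Fin (P.N k))
    (h : ∃ i, Qual F j F' j' i) : Fin P.S :=
  (Finset.univ.filter fun i => Qual F j F' j' i).min'
    (by obtain ⟨i, hi⟩ := h; exact ⟨i, Finset.mem_filter.mpr ⟨Finset.mem_univ _, hi⟩⟩)

/-- The double-section member contributed by a qualifying lower box: centre (in the coordinates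
of the upper frame) at the common short edge of sections `i₀`, `i₀ + 1` of the lower box, level
index `k - 1`. [cite: Hochman2025, §5.3 (3)] -/
def ddDiamond {n k : ℕ} (F : Frame P n) (F' : Frame P k) (j' : Fin (P.N k)) (i₀ : Fin P.S) :
    SafePoints.Diamond where
  c := ((F.φ F'.c).1 - P.r k / 10 - ((i₀ : ℝ) + 1) * P.ℓ k, (F.φ F'.c).2 + F'.t j' + P.h k / 2)
  n := k - 1

/-- The two side strips of box `(F, j)` as members (level index `n - 1`): centred
`h/200` below the lower long side and `h/200` above the upper long side, halfway along the box.
[cite: Hochman2025, §5.3 (3) (`B', B''`)] -/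
def stripLo {n : ℕ} (F : Frame P n) (j : Fin (P.N n)) : SafePoints.Diamond :=
  SafePoints.Diamond.mk (-((109 / 200) * P.r n), F.t j - P.h n / 200) (n - 1)

/-- See `stripLo`. [cite: Hochman2025, §5.3 (3) (`B', B''`)] -/
def stripHi {n : ℕ} (F : Frame P n) (j : Fin (P.N n)) : SafePoints.Diamond :=
  SafePoints.Diamond.mk (-((109 / 200) * P.r n), F.t j + P.h n + P.h n / 200) (n - 1)

open Classical in
/-- The two side strips as a finite family. [cite: Hochman2025, §5.3 (3)] -/
def stripDiamonds {n : ℕ} (F : Frame P n) (j : Fin (P.N n)) : Finset SafePoints.Diamond :=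
  {stripLo F j, stripHi F j}

/-- The set of double-section members of the family of box `(F, j)`. [cite: Hochman2025, §5.3 (3)] -/
def lowerMembers {n : ℕ} (F : Frame P n) (j : Fin (P.N n)) : Set SafePoints.Diamond :=
  {D | ∃ (k : ℕ) (_ : 1 ≤ k ∧ k < n) (F' : Frame P k) (_ : F' ∈ C.frames k) (_ : F'.k = F.k)
      (j' : Fin (P.N k)) (h : ∃ i, Qual F j F' j' i), D = ddDiamond F F' j' (qualIdx F j F' j' h)}

/-- **The obstacle family `R_C(B)`** of box `(F, j)` as a set of diamonds (strips and double
sections). [cite: Hochman2025, §5.3 (3)] -/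
def familySet {n : ℕ} (F : Frame P n) (j : Fin (P.N n)) : Set SafePoints.Diamond :=
  ↑(stripDiamonds F j) ∪ C.lowerMembers F j

/-- **Safety of the witnesses** (§5.3 (3): "`w_C(B)` is safe relative to `R_C(B)` in the sense
of Proposition 4.1"), for the envelope-hull safe set of §4 in the coordinates of the frame of the
box, stated for every finite enumeration of the family (the family is finite for well-formed
certificates, `familySet_finite`). [cite: Hochman2025, §5.3 (3)] -/
def WitSafe (hP : P.Good) : Prop :=
  ∀ n, 1 ≤ n → ∀ F ∈ C.frames n, ∀ j, ∀ 𝔉 : Finset SafePoints.Diamond,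
    (↑𝔉 : Set SafePoints.Diamond) = C.familySet F j →
      F.φ (F.w j) ∈ SafePoints.safe (P.famScales hP n) 𝔉

/-- **A certificate** in the sense of §5.3: well formed and with safe witnesses.
[cite: Hochman2025, §5.3] -/
structure Valid (hP : P.Good) : Prop where
  wf : C.WF
  safe : C.WitSafe hP

end Cert


namespace Params

variable {P : Params}

/-- Radii grow at least `10⁴`-fold per level. [cite: Hochman2025, §5.2] -/
theorem r_lt_le (hP : P.Good) (n : ℕ) : 10000 * P.r n ≤ P.r (n + 1) := by
  have h1 := hP.r_le_h n
  have h2 := hP.h_le_ℓ (n + 1)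
  have h3 := ℓ_le_wB hP (n + 1)
  unfold wB at h3
  linarith [P.r_pos (n + 1)]

/-- Radii are monotone. [folklore] -/
theorem r_mono (hP : P.Good) {k n : ℕ} (h : k ≤ n) : P.r k ≤ P.r n := by
  induction h with
  | refl => exact le_rfl
  | @step m _ ih =>
    have := r_lt_le hP m
    linarith [P.r_pos k]

/-- Sections of a higher level are much longer than lower radii: `100 r_n < ℓ_{n'}` for
`n < n'`. [cite: Hochman2025, §5.2] -/
theorem r_lt_ℓ (hP : P.Good) {n n' : ℕ} (h : n < n') : 100 * P.r n < P.ℓ n' := by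
  obtain ⟨m, rfl⟩ := Nat.exists_eq_add_of_lt h
  have h1 := hP.r_le_h (n + m)
  have h2 := hP.h_le_ℓ (n + m + 1)
  have h3 := r_mono hP (Nat.le_add_right n m)
  have h4 := P.h_pos (n + m + 1)
  linarith [P.r_pos n]

/-- `h ≤ ℓ / 5`. [folklore] -/
theorem h_le (hP : P.Good) (n : ℕ) : P.h n ≤ P.ℓ n / 5 := by
  have := hP.h_le_ℓ n; linarith

end Params

namespace Cert

variable {C : Cert P}

/-- Points of a doubled section are within `1.6 r` of the centre of the frame (in norm).
[folklore] -/
theorem norm_sub_le_of_mem_sect2 (hP : P.Good) {k : ℕ} (F' : Frame P k) (hF' : F'.WF)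
    (j' : Fin (P.N k)) (i : Fin P.S) {p : ℂ} (hp : p ∈ F'.sect2 j' i) :
    ‖p - F'.c‖ ≤ 16 / 10 * P.r k := by
  obtain ⟨h1, h2, h3, h4⟩ := hp
  have hr := P.r_pos k
  have hℓ : 89 / 100 * P.r k / P.S = P.ℓ k := rfl
  rw [hℓ] at h1 h2
  have hℓw := Params.ℓ_le_wB hP k
  have hℓp := Params.ℓ_pos hP k
  unfold Params.wB at hℓw
  have hband := hF'.band j'
  rw [abs_le, abs_le] at hband
  have hhk := Params.h_le hP k
  have hi0 : (0 : ℝ) ≤ (i : ℝ) := by positivity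
  have hiS : ((i : ℝ) + 1) * P.ℓ k ≤ 89 / 100 * P.r k := by
    have hi' : ((i : ℝ) + 1) ≤ P.S := by exact_mod_cast i.2
    have hS : (0 : ℝ) < P.S := by exact_mod_cast lt_of_lt_of_le (by norm_num) hP.S_le
    calc ((i : ℝ) + 1) * P.ℓ k ≤ (P.S : ℝ) * P.ℓ k := mul_le_mul_of_nonneg_right hi' hℓp.le
      _ = 89 / 100 * P.r k := by unfold Params.ℓ Params.wB; field_simp
  -- `‖p - c‖ ≤ |x| + |y|`
  have hn : ‖p - F'.c‖ = ‖starRingEnd ℂ F'.v * (p - F'.c)‖ := by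
    rw [norm_mul, Complex.norm_conj, F'.norm_v, one_mul]
  rw [hn]
  have := Complex.norm_le_abs_re_add_abs_im (starRingEnd ℂ F'.v * (p - F'.c))
  have hx : |(starRingEnd ℂ F'.v * (p - F'.c)).re| ≤ 15 / 10 * P.r k := by
    change |(Plane.coords F'.v F'.c p).1| ≤ _
    have him : (↑↑i + 1) * P.ℓ k + P.ℓ k / 2 ≤ 14 / 10 * P.r k := by nlinarith
    rw [abs_le]; constructor <;> nlinarith
  have hy : |(starRingEnd ℂ F'.v * (p - F'.c)).im| ≤ P.r k / 10 := by
    change |(Plane.coords F'.v F'.c p).2| ≤ _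
    rw [abs_le]; constructor <;> nlinarith [hband.1.1, hband.2.2]
  linarith

/-- A qualifying lower box belongs to a frame whose centre is within `3 r_n` of the centre of
the upper frame. [folklore] -/
theorem norm_sub_le_of_qual (hP : P.Good) {n k : ℕ} (hkn : k ≤ n) {F : Frame P n} (hF : F.WF)
    {j : Fin (P.N n)} {F' : Frame P k} (hF' : F'.WF) {j' : Fin (P.N k)} {i : Fin P.S}
    (hq : Qual F j F' j' i) : ‖F'.c - F.c‖ ≤ 3 * P.r n := by
  obtain ⟨p, hp2, hp⟩ := hq
  have h1 : ‖p - F'.c‖ ≤ 16 / 10 * P.r k := norm_sub_le_of_mem_sect2 hP F' hF' j' i hp2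
  have h2 : ‖p - F.c‖ ≤ P.r n := by
    have := hF.box_subset_disk F j (Plane.section_subset_box F.v F.c (P.r_pos n).le
      (lt_of_lt_of_le (by norm_num) hP.S_le) i hp)
    rwa [Frame.disk, Metric.mem_closedBall, Complex.dist_eq] at this
  have h3 := Params.r_mono hP hkn
  calc ‖F'.c - F.c‖ = ‖(p - F.c) - (p - F'.c)‖ := by ring_nf
    _ ≤ ‖p - F.c‖ + ‖p - F'.c‖ := norm_sub_le _ _
    _ ≤ 3 * P.r n := by linarith [P.r_pos k]

/-- **The obstacle family of a box of a well-formed certificate is finite.**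
[cite: Hochman2025, §5.3 (3)] -/
theorem familySet_finite (hP : P.Good) (hC : C.WF) {n : ℕ} {F : Frame P n} (hF : F ∈ C.frames n)
    (j : Fin (P.N n)) : (C.familySet F j).Finite := by
  refine Set.Finite.union (Finset.finite_toSet _) ?_
  -- cover the lower members by a finite union
  have hcov : C.lowerMembers F j ⊆ ⋃ k ∈ Finset.range n, ⋃ F' ∈ {F' ∈ C.frames k | ‖F'.c - F.c‖ ≤ 3 * P.r n},
      ⋃ j' : Fin (P.N k), ⋃ h : ∃ i, Qual F j F' j' i, {ddDiamond F F' j' (qualIdx F j F' j' h)} := by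
    rintro D ⟨k, hk, F', hF', hkk, j', h, rfl⟩
    simp only [Set.mem_iUnion, Set.mem_singleton_iff, exists_prop, Finset.mem_range, Set.mem_setOf_eq]
    obtain ⟨i, hi⟩ := h
    exact ⟨k, hk.2, F', ⟨hF', norm_sub_le_of_qual hP hk.2.le (hC.frame n F hF) (hC.frame k F' hF') hi⟩,
      j', ⟨i, hi⟩, rfl⟩
  refine Set.Finite.subset ?_ hcov
  refine Set.Finite.biUnion (Finset.finite_toSet _) fun k _ => ?_
  refine Set.Finite.biUnion (hC.finite_near k F.c (3 * P.r n)) fun F' _ => ?_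
  refine Set.finite_iUnion fun j' => ?_
  exact Set.finite_iUnion fun _ => Set.finite_singleton _

/-- Qualifying indices of one lower box differ by at most one (the lower box is tiny compared
with the sections of the upper box). [folklore] -/
theorem qual_le_succ (hP : P.Good) {n k : ℕ} (hkn : k < n) {F : Frame P n} {j : Fin (P.N n)}
    {F' : Frame P k} (hF' : F'.WF) {j' : Fin (P.N k)} {i i' : Fin P.S}
    (hi : Qual F j F' j' i) (hi' : Qual F j F' j' i') : (i' : ℕ) ≤ i + 1 := by
  by_contra hlt
  push Not at hlt
  obtain ⟨p, hp2, hp⟩ := hi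
  obtain ⟨q, hq2, hq⟩ := hi'
  have h1 := norm_sub_le_of_mem_sect2 hP F' hF' j' i hp2
  have h2 := norm_sub_le_of_mem_sect2 hP F' hF' j' i' hq2
  have hpq : ‖p - q‖ ≤ 32 / 10 * P.r k := by
    calc ‖p - q‖ = ‖(p - F'.c) - (q - F'.c)‖ := by ring_nf
      _ ≤ ‖p - F'.c‖ + ‖q - F'.c‖ := norm_sub_le _ _
      _ ≤ 32 / 10 * P.r k := by linarith
  -- in the coordinates of `F`, the sections `i`, `i'` are `≥ ℓ_n` apart when `i' ≥ i + 2`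
  obtain ⟨hx, -⟩ := Plane.abs_coords_sub_le F.v F.c p q F.norm_v
  obtain ⟨hp1, hp2', -, -⟩ := hp
  obtain ⟨hq1, hq2', -, -⟩ := hq
  have hℓ : 89 / 100 * P.r n / P.S = P.ℓ n := rfl
  rw [hℓ] at hp1 hp2' hq1 hq2'
  have hℓp := Params.ℓ_pos hP n
  have hii' : (i : ℝ) + 2 ≤ (i' : ℝ) := by exact_mod_cast hlt
  have hbig := Params.r_lt_ℓ hP hkn
  rw [abs_le] at hx
  nlinarith [mul_le_mul_of_nonneg_right hii' hℓp.le]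

end Cert


namespace Params

variable {P : Params}

/-- The obstacle scales at the index of a lower level `k < n`: `a = 4 ℓ_k`. [folklore] -/
theorem famScales_a (hP : P.Good) {n k : ℕ} (hk : 1 ≤ k) (hkn : k < n) :
    (P.famScales hP n).a (k - 1) = 4 * P.ℓ k := by
  unfold famScales
  rw [SafePoints.Scales.extendScales_a_of_lt _ (by omega : k - 1 < n)]
  unfold famA
  have h1 : k - 1 + 1 = k := by omega
  rw [h1, if_pos hkn]
  ring

/-- The obstacle scales at the index of a lower level `k < n`: `b = 2 h_k`. [folklore] -/
theorem famScales_b (hP : P.Good) {n k : ℕ} (hk : 1 ≤ k) (hkn : k < n) :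
    (P.famScales hP n).b (k - 1) = 2 * P.h k := by
  unfold famScales
  rw [SafePoints.Scales.extendScales_b_of_lt _ (by omega : k - 1 < n)]
  unfold famB
  have h1 : k - 1 + 1 = k := by omega
  rw [h1, if_pos hkn]

end Params

namespace Cert

variable {C : Cert P}

/-- Frames with the same orientation index have the same orientation vector. [folklore] -/
theorem v_eq_of_k_eq {n n' : ℕ} {F : Frame P n} {F' : Frame P n'} (hk : F'.k = F.k) : F'.v = F.v := by
  simp [Frame.v, hk]

/-- The least qualifying index qualifies. [folklore] -/
theorem qual_qualIdx {n k : ℕ} (F : Frame P n) (j : Fin (P.N n)) (F' : Frame P k) (j' : Fin (P.N k))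
    (h : ∃ i, Qual F j F' j' i) : Qual F j F' j' (qualIdx F j F' j' h) := by
  classical
  have := Finset.min'_mem (Finset.univ.filter fun i => Qual F j F' j' i)
    (by obtain ⟨i, hi⟩ := h; exact ⟨i, Finset.mem_filter.mpr ⟨Finset.mem_univ _, hi⟩⟩)
  unfold qualIdx
  convert (Finset.mem_filter.mp this).2

/-- The least qualifying index is least. [folklore] -/
theorem qualIdx_le {n k : ℕ} (F : Frame P n) (j : Fin (P.N n)) (F' : Frame P k) (j' : Fin (P.N k))
    (h : ∃ i, Qual F j F' j' i) {i : Fin P.S} (hi : Qual F j F' j' i) : qualIdx F j F' j' h ≤ i := by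
  classical
  unfold qualIdx
  convert Finset.min'_le (Finset.univ.filter fun i => Qual F j F' j' i) i
    (Finset.mem_filter.mpr ⟨Finset.mem_univ _, hi⟩)

/-- **Lemma 5.2** (witnesses of the same class at different levels are `≥ h/2` apart, `h` the
height of the lower box): let `B = (F, j)` be a box of level `n` and `B' = (F', j')` a box of
level `n' > n` with the same orientation, and suppose their witnesses lie in sections of the
same index `i`. Either `2B(i) ∩ B'(i) = ∅`, so `w' ∉ 2B(i)`; or `B` qualifies for `B'`, its
double section `DD(i₀)` (`i₀ ≤ i ≤ i₀ + 1`) belongs to `R_C(B')`, and the safety of `w'` puts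
`w'` outside `◇(2·DD) ⊇ 2B(i)`. In both cases `d(w, w') ≥ h_n / 2`.
[cite: Hochman2025, Lemma 5.2] -/
theorem lemma_5_2 (hP : P.Good) (hV : C.Valid hP) {n n' : ℕ} (hn : 1 ≤ n) (hnn' : n < n')
    {F : Frame P n} (hF : F ∈ C.frames n) {F' : Frame P n'} (hF' : F' ∈ C.frames n')
    (hk : F'.k = F.k) (j : Fin (P.N n)) (j' : Fin (P.N n')) (hσ : F.σ j = F'.σ j') :
    P.h n / 2 ≤ ‖F.w j - F'.w j'‖ := by
  set i := F.σ j with hi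
  have hwf := hV.wf.frame n F hF
  have hwf' := hV.wf.frame n' F' hF'
  have hw : F.w j ∈ F.sect j i := hwf.wit j
  have hw' : F'.w j' ∈ F'.sect j' i := by
    have := hwf'.wit j'
    rwa [← hσ] at this
  have hhℓ : P.h n ≤ 89 / 100 * P.r n / P.S := by
    have := Params.h_le hP n
    have h2 : 89 / 100 * P.r n / P.S = P.ℓ n := rfl
    linarith [Params.ℓ_pos hP n]
  apply Plane.dist_ge_of_not_mem_section2 F.v F.c F.norm_v hhℓ i hw
  -- suppose `w' ∈ 2B(i)`
  intro hmem
  have hq : Qual F' j' F j i := ⟨F'.w j', hmem, hw'⟩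
  have hex : ∃ i, Qual F' j' F j i := ⟨i, hq⟩
  set i₀ := qualIdx F' j' F j hex with hi₀
  have hi₀i : i₀ ≤ i := qualIdx_le F' j' F j hex hq
  have hii₀ : (i : ℕ) ≤ i₀ + 1 := qual_le_succ hP hnn' hwf (qual_qualIdx F' j' F j hex) hq
  -- the member `DD(i₀)` of the family of `B'`
  set D := ddDiamond F' F j i₀ with hD
  have hDmem : D ∈ C.familySet F' j' :=
    Or.inr ⟨n, ⟨hn, hnn'⟩, F, hF, hk.symm ▸ rfl, j, hex, rfl⟩
  set 𝔉 := (familySet_finite hP hV.wf hF' j').toFinset with h𝔉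
  have h𝔉eq : (↑𝔉 : Set SafePoints.Diamond) = C.familySet F' j' := Set.Finite.coe_toFinset _
  have hsafe := hV.safe n' (by omega) F' hF' j' 𝔉 h𝔉eq
  have hD𝔉 : D ∈ 𝔉 := by rw [h𝔉, Set.Finite.mem_toFinset]; exact hDmem
  have hempty := SafePoints.safe_inter_toSet (σ := P.famScales hP n') hD𝔉
  -- `φ(w') ∈ ◇(DD)`: contradiction
  have hmemD : F'.φ (F'.w j') ∈ D.toSet (P.famScales hP n') := by
    rw [SafePoints.Diamond.mem_toSet_iff]
    have hDn : D.n = n - 1 := rfl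
    rw [hDn, Params.famScales_a hP hn hnn', Params.famScales_b hP hn hnn']
    -- coordinates
    have hv : F'.v = F.v := v_eq_of_k_eq hk
    have hφ : F'.φ (F'.w j') = F'.φ F.c + Plane.coords F.v F.c (F'.w j') := by
      simp only [Frame.φ, hv]
      rw [Plane.coords_eq_sub F.v F.c (F'.w j'), Plane.coords_eq_sub F.v F'.c (F'.w j'),
        Plane.coords_eq_sub F.v F'.c F.c]
      abel
    obtain ⟨h1, h2, h3, h4⟩ := hmem
    have hℓ : 89 / 100 * P.r n / P.S = P.ℓ n := rfl
    rw [hℓ] at h1 h2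
    have hDc1 : D.c.1 = (F'.φ F.c).1 - P.r n / 10 - ((i₀ : ℝ) + 1) * P.ℓ n := rfl
    have hDc2 : D.c.2 = (F'.φ F.c).2 + F.t j + P.h n / 2 := rfl
    rw [hφ, Prod.fst_add, Prod.snd_add, hDc1, hDc2]
    have hi₀i' : (i₀ : ℝ) ≤ (i : ℝ) := by exact_mod_cast hi₀i
    have hii₀' : (i : ℝ) ≤ (i₀ : ℝ) + 1 := by exact_mod_cast hii₀
    have hℓp := Params.ℓ_pos hP n
    have hhp := P.h_pos n
    have hx : |(F'.φ F.c).1 + (Plane.coords F.v F.c (F'.w j')).1 -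
        ((F'.φ F.c).1 - P.r n / 10 - (↑↑i₀ + 1) * P.ℓ n)| ≤ 3 / 2 * P.ℓ n := by
      rw [abs_le]; constructor <;> nlinarith
    have hy : |(F'.φ F.c).2 + (Plane.coords F.v F.c (F'.w j')).2 -
        ((F'.φ F.c).2 + F.t j + P.h n / 2)| ≤ P.h n := by
      rw [abs_le]; constructor <;> linarith
    nlinarith
  have : F'.φ (F'.w j') ∈ SafePoints.safe (P.famScales hP n') 𝔉 ∩ D.toSet (P.famScales hP n') :=
    ⟨hsafe, hmemD⟩
  rw [hempty] at this
  exact this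

end Cert


namespace Cert

variable {C : Cert P}

/-- **Corollary 5.3, same frame**: witnesses of two different boxes of one frame are `≥ 100 h`
apart (the boxes are `100 h` apart across). [cite: Hochman2025, Cor 5.3] -/
theorem cor_5_3_same_frame (hP : P.Good) (hC : C.WF) {n : ℕ} {F : Frame P n} (hF : F ∈ C.frames n)
    {j j' : Fin (P.N n)} (hjj' : j ≠ j') : 100 * P.h n ≤ ‖F.w j - F.w j'‖ := by
  have hwf := hC.frame n F hF
  obtain ⟨-, -, h3, h4⟩ := Plane.section_subset_box F.v F.c (P.r_pos n).le
    (lt_of_lt_of_le (by norm_num) hP.S_le) _ (hwf.wit j)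
  obtain ⟨-, -, h3', h4'⟩ := Plane.section_subset_box F.v F.c (P.r_pos n).le
    (lt_of_lt_of_le (by norm_num) hP.S_le) _ (hwf.wit j')
  have hapart := hwf.apart j j' hjj'
  obtain ⟨-, hy⟩ := Plane.abs_coords_sub_le F.v F.c (F.w j) (F.w j') F.norm_v
  rw [abs_le] at hy
  rw [le_abs] at hapart
  rcases hapart with h | h <;> linarith [P.h_pos n]

/-- **Corollary 5.3, same level, different frames**: witnesses in sections of the same index of
boxes with the same orientation in two different frames of one level are `> r/4` apart
(Lemma 5.1 and the `r/2`-separation of centres). [cite: Hochman2025, Cor 5.3] -/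
theorem cor_5_3_same_level (hP : P.Good) (hC : C.WF) {n : ℕ} {F F' : Frame P n} (hF : F ∈ C.frames n)
    (hF' : F' ∈ C.frames n) (hne : F ≠ F') (hk : F'.k = F.k) {j j' : Fin (P.N n)}
    (hσ : F.σ j = F'.σ j') : P.r n / 4 < ‖F.w j - F'.w j'‖ := by
  have hwf := hC.frame n F hF
  have hwf' := hC.frame n F' hF'
  have hsep := hC.sep n F hF F' hF' hne
  have hv : F'.v = F.v := v_eq_of_k_eq hk
  have hw : F.w j ∈ Plane.section_ F.v F.c (P.r n) (P.h n) (F.t j) P.S (F.σ j) := hwf.wit j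
  have hw' : F'.w j' ∈ Plane.section_ F.v F'.c (P.r n) (P.h n) (F'.t j') P.S (F.σ j) := by
    have := hwf'.wit j'
    rwa [Frame.sect, hv, ← hσ] at this
  exact Plane.lemma_5_1 F.v F.c F'.c F.norm_v (P.r_pos n) (le_trans (by norm_num) hP.S_le) hsep
    (hwf.band j).1 (hwf.band j).2 (hwf'.band j').1 (hwf'.band j').2 (F.σ j) _ hw _ hw'

/-- **Corollary 5.3, different levels** (= Lemma 5.2, recorded symmetrically): witnesses of the
same class at levels `n ≠ n'` are `≥ h_{min} / 2` apart. [cite: Hochman2025, Cor 5.3] -/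
theorem cor_5_3_levels (hP : P.Good) (hV : C.Valid hP) {n n' : ℕ} (hn : 1 ≤ n) (hnn' : n < n')
    {F : Frame P n} (hF : F ∈ C.frames n) {F' : Frame P n'} (hF' : F' ∈ C.frames n')
    (hk : F'.k = F.k) (j : Fin (P.N n)) (j' : Fin (P.N n')) (hσ : F.σ j = F'.σ j') :
    P.h n / 2 ≤ ‖F.w j - F'.w j'‖ ∧ P.h n / 2 ≤ ‖F'.w j' - F.w j‖ := by
  have := lemma_5_2 hP hV hn hnn' hF hF' hk j j' hσ
  exact ⟨this, by rwa [norm_sub_rev]⟩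

end Cert


/-! ### Sparsity of the obstacle family (so that Prop. 4.1 (2)–(3) apply to it) -/

namespace SafePoints

/-- The rectangle scales whose associated diamonds are the given scales (`w = a/2`, `h = b/2`).
[folklore] -/
def RectScales.ofScales (σ : Scales) : RectScales where
  w n := σ.a n / 2
  h n := σ.b n / 2
  w_pos n := half_pos (σ.a_pos n)
  h_pos n := half_pos (σ.b_pos n)

/-- `(ofScales σ).toScales = σ`. [folklore] -/
@[simp] theorem RectScales.toScales_ofScales (σ : Scales) : (RectScales.ofScales σ).toScales = σ := by
  cases σ
  simp only [RectScales.toScales, RectScales.ofScales]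
  congr 1 <;> funext n <;> ring

end SafePoints

namespace Plane

/-- The Euclidean distance is at most the `ℓ¹`-distance of frame coordinates (unit `v`).
[folklore] -/
theorem norm_sub_le_coords (v c p q : ℂ) (hv : ‖v‖ = 1) :
    ‖p - q‖ ≤ |(coords v c p).1 - (coords v c q).1| + |(coords v c p).2 - (coords v c q).2| := by
  have e1 : (coords v c p).1 - (coords v c q).1 = (starRingEnd ℂ v * (p - q)).re := by
    simp only [coords, ← Complex.sub_re, ← mul_sub]; ring_nf
  have e2 : (coords v c p).2 - (coords v c q).2 = (starRingEnd ℂ v * (p - q)).im := by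
    simp only [coords, ← Complex.sub_im, ← mul_sub]; ring_nf
  rw [e1, e2]
  have hn : ‖p - q‖ = ‖starRingEnd ℂ v * (p - q)‖ := by
    rw [norm_mul, Complex.norm_conj, hv, one_mul]
  rw [hn]
  exact Complex.norm_le_abs_re_add_abs_im _

end Plane

namespace Params

variable {P : Params}

/-- `h_k ≤ r_k / 10000` for `k ≥ 1` (the boxes of a frame fit in the band). [folklore] -/
theorem h_le_r (hP : P.Good) {k : ℕ} (hk : 1 ≤ k) : 10000 * P.h k ≤ P.r k := by
  have h1 := hP.boxes_fit k
  have hN : (1 : ℝ) ≤ P.N k := by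
    have hb : 1 ≤ P.buckets k := by
      unfold buckets
      have hT : 1 ≤ P.T := le_trans (by norm_num) hP.T_le
      have hS : 1 ≤ P.S := le_trans (by norm_num) hP.S_le
      have hk2 : 1 ≤ k ^ 2 := Nat.one_le_pow _ _ hk
      calc 1 = 1 * 1 * 1 := by ring
        _ ≤ k ^ 2 * P.T * P.S := Nat.mul_le_mul (Nat.mul_le_mul hk2 hT) hS
    have : 1 ≤ P.N k := by
      unfold N
      calc 1 = 1 * 1 := by ring
        _ ≤ P.buckets k * 2 ^ (P.buckets k + 1) := Nat.mul_le_mul hb Nat.one_le_two_pow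
    exact_mod_cast this
  nlinarith [P.h_pos k]

/-- `85 ℓ_k < r_k / 4` (since `S ≥ 1000`). [folklore] -/
theorem ℓ_small (hP : P.Good) (k : ℕ) : 85 * P.ℓ k < P.r k / 4 := by
  unfold ℓ wB
  have hS : (1000 : ℝ) ≤ P.S := by exact_mod_cast hP.S_le
  have hr := P.r_pos k
  rw [div_eq_mul_inv]
  have hSinv : (P.S : ℝ)⁻¹ ≤ 1 / 1000 := by
    rw [one_div]; exact inv_anti₀ (by norm_num) hS
  have : 85 * (89 / 100 * P.r k * (P.S : ℝ)⁻¹) ≤ 85 * (89 / 100 * P.r k * (1 / 1000)) := by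
    have h0 : 0 ≤ 89 / 100 * P.r k := by positivity
    nlinarith [mul_le_mul_of_nonneg_left hSinv h0]
  linarith

end Params

namespace Cert

variable {C : Cert P}

/-- Two lower boxes of the same level qualifying for the same upper box at indices `i₁, i₂`,
whose frames have nearby first coordinates (`≤ 2 r_k` apart in the upper frame), qualify at
indices differing by at most one. [folklore] -/
theorem qual_idx_le_of_close (hP : P.Good) {n k : ℕ} (hkn : k < n) {F : Frame P n} {j : Fin (P.N n)}
    {F₁ F₂ : Frame P k} (hF₁ : F₁.WF) (hF₂ : F₂.WF) {j₁ j₂ : Fin (P.N k)} {i₁ i₂ : Fin P.S}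
    (hq₁ : Qual F j F₁ j₁ i₁) (hq₂ : Qual F j F₂ j₂ i₂)
    (hclose : |(F.φ F₁.c).1 - (F.φ F₂.c).1| ≤ 2 * P.r k) : (i₂ : ℕ) ≤ i₁ + 1 := by
  by_contra hlt
  push Not at hlt
  obtain ⟨p, hp2, hp⟩ := hq₁
  obtain ⟨q, hq2, hq⟩ := hq₂
  have h1 := norm_sub_le_of_mem_sect2 hP F₁ hF₁ j₁ i₁ hp2
  have h2 := norm_sub_le_of_mem_sect2 hP F₂ hF₂ j₂ i₂ hq2
  obtain ⟨hx1, -⟩ := Plane.abs_coords_sub_le F.v F.c p F₁.c F.norm_v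
  obtain ⟨hx2, -⟩ := Plane.abs_coords_sub_le F.v F.c q F₂.c F.norm_v
  obtain ⟨hp1, hp2', -, -⟩ := hp
  obtain ⟨hq1, hq2', -, -⟩ := hq
  have hℓ : 89 / 100 * P.r n / P.S = P.ℓ n := rfl
  rw [hℓ] at hp1 hp2' hq1 hq2'
  have hℓp := Params.ℓ_pos hP n
  have hii' : (i₁ : ℝ) + 2 ≤ (i₂ : ℝ) := by exact_mod_cast hlt
  have hbig := Params.r_lt_ℓ hP hkn
  change |(F.φ p).1 - (F.φ F₁.c).1| ≤ _ at hx1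
  change |(F.φ q).1 - (F.φ F₂.c).1| ≤ _ at hx2
  change _ ≤ (F.φ p).1 at hp1
  change (F.φ q).1 ≤ _ at hq2'
  rw [abs_le] at hx1 hx2 hclose
  nlinarith [mul_le_mul_of_nonneg_right hii' hℓp.le, P.r_pos k]

/-- **The obstacle family of a box is sparse** (`RectSparse` for the rectangle scales of
`famScales`): the two strips are `1.01 h` apart across; two double sections of the same level
come from different boxes of one frame (`≥ 101 h` apart across) or from different frames, whose
centres are `≥ r/2` apart — across this gives `≥ 0.23 r`, and along the box it is incompatible
with both members qualifying unless they are `≥ 84 ℓ` apart (their qualifying indices would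
differ by `≤ 1`, forcing the centres within `85 ℓ < r/4` along and `< r/4` across).
[cite: Hochman2025, §5.3 ("this collection is 80-sparse") with Lemma 5.1] -/
theorem familySet_rectSparse (hP : P.Good) (hC : C.WF) {n : ℕ} (hn : 1 ≤ n) (F : Frame P n)
    (j : Fin (P.N n)) (𝔉 : Finset SafePoints.Diamond)
    (h𝔉 : (↑𝔉 : Set SafePoints.Diamond) = C.familySet F j) :
    SafePoints.RectSparse (SafePoints.RectScales.ofScales (P.famScales hP n)) 𝔉 := by
  intro D hD D' hD' hne hlev
  have hDm : D ∈ C.familySet F j := by rw [← h𝔉]; exact hD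
  have hD'm : D' ∈ C.familySet F j := by rw [← h𝔉]; exact hD'
  simp only [SafePoints.RectScales.ofScales]
  have hhn := P.h_pos n
  -- level index of strips is `n - 1`, of double sections `k - 1 ≤ n - 2`
  rcases hDm with hDs | ⟨k, hk, F₁, hF₁, hk₁, j₁, h₁, rfl⟩ <;>
    rcases hD'm with hD's | ⟨k', hk', F₂, hF₂, hk₂, j₂, h₂, hDD⟩
  · -- two strips
    simp only [stripDiamonds, Finset.coe_insert, Finset.coe_singleton, Set.mem_insert_iff,
      Set.mem_singleton_iff] at hDs hD's
    have hb : (P.famScales hP n).b (n - 1) = 2 * (P.h n / 100) := by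
      unfold Params.famScales
      rw [SafePoints.Scales.extendScales_b_of_lt _ (by omega : n - 1 < n)]
      unfold Params.famB
      rw [if_neg (by omega)]
    rcases hDs with rfl | rfl <;> rcases hD's with rfl | rfl
    · exact absurd rfl hne
    · right
      change 42 * ((P.famScales hP n).b (n - 1) / 2) ≤ |(F.t j - P.h n / 200) - (F.t j + P.h n + P.h n / 200)|
      rw [hb, abs_of_nonpos (by linarith)]
      linarith
    · right
      change 42 * ((P.famScales hP n).b (n - 1) / 2) ≤ |(F.t j + P.h n + P.h n / 200) - (F.t j - P.h n / 200)|
      rw [hb, abs_of_nonneg (by linarith)]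
      linarith
    · exact absurd rfl hne
  · -- strip vs double section: different level indices
    exfalso
    simp only [stripDiamonds, Finset.coe_insert, Finset.coe_singleton, Set.mem_insert_iff,
      Set.mem_singleton_iff] at hDs
    have h1 : D.n = n - 1 := by rcases hDs with rfl | rfl <;> rfl
    have h2 : D'.n = k' - 1 := by rw [hDD]; rfl
    omega
  · exfalso
    simp only [stripDiamonds, Finset.coe_insert, Finset.coe_singleton, Set.mem_insert_iff,
      Set.mem_singleton_iff] at hD's
    have h1 : D'.n = n - 1 := by rcases hD's with rfl | rfl <;> rfl
    have h2 : (ddDiamond F F₁ j₁ (qualIdx F j F₁ j₁ h₁)).n = k - 1 := rfl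
    omega
  · -- two double sections, necessarily of the same level `k = k'`
    have hkk' : k = k' := by
      have h1 : (ddDiamond F F₁ j₁ (qualIdx F j F₁ j₁ h₁)).n = k - 1 := rfl
      have h2 : D'.n = k' - 1 := by rw [hDD]; rfl
      omega
    subst hkk'
    subst hDD
    have hwf₁ := hC.frame k F₁ hF₁
    have hwf₂ := hC.frame k F₂ hF₂
    have hk1 : 1 ≤ k := hk.1
    have ha : (P.famScales hP n).a (k - 1) = 4 * P.ℓ k := Params.famScales_a hP hk1 hk.2
    have hb : (P.famScales hP n).b (k - 1) = 2 * P.h k := Params.famScales_b hP hk1 hk.2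
    change 42 * ((P.famScales hP n).a (k - 1) / 2) ≤ _ ∨ 42 * ((P.famScales hP n).b (k - 1) / 2) ≤ _
    rw [ha, hb]
    simp only [ddDiamond]
    set i₁ := qualIdx F j F₁ j₁ h₁ with hi₁
    set i₂ := qualIdx F j F₂ j₂ h₂ with hi₂
    have hhk := P.h_pos k
    have hℓk := Params.ℓ_pos hP k
    by_cases hF₁₂ : F₁ = F₂
    · -- same frame, different boxes
      subst hF₁₂
      have hj : j₁ ≠ j₂ := by
        rintro rfl
        exact hne rfl
      right
      have := hwf₁.apart j₁ j₂ hj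
      have e : (F.φ F₁.c).2 + F₁.t j₁ + P.h k / 2 - ((F.φ F₁.c).2 + F₁.t j₂ + P.h k / 2) = F₁.t j₁ - F₁.t j₂ := by
        ring
      rw [e]
      linarith
    · -- different frames of level `k`: centres `≥ r_k / 2` apart
      have hsep := hC.sep k F₁ hF₁ F₂ hF₂ hF₁₂
      by_contra hcon
      rw [not_or, not_le, not_le] at hcon
      obtain ⟨hx, hy⟩ := hcon
      have hrk := P.r_pos k
      have hhr := Params.h_le_r hP hk1
      have hband₁ := hwf₁.band j₁
      have hband₂ := hwf₂.band j₂
      rw [abs_le] at hband₁ hband₂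
      -- across: the second coordinates of the centres are within `r/4`
      have hy' : |(F.φ F₁.c).2 - (F.φ F₂.c).2| < P.r k / 4 := by
        rw [abs_lt] at hy ⊢
        constructor <;> nlinarith [hband₁.1.1, hband₁.1.2, hband₂.1.1, hband₂.1.2]
      -- hence along they are `≥ r/4` apart
      have hnorm := Plane.norm_sub_le_coords F.v F.c F₁.c F₂.c F.norm_v
      change ‖F₁.c - F₂.c‖ ≤ |(F.φ F₁.c).1 - (F.φ F₂.c).1| + |(F.φ F₁.c).2 - (F.φ F₂.c).2| at hnorm
      have hx' : P.r k / 4 < |(F.φ F₁.c).1 - (F.φ F₂.c).1| := by linarith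
      -- along: the centres are within `|i₁ - i₂| ℓ + 84 ℓ ≤ r` of each other, so the indices differ by ≤ 1
      have hiS₁ : ((i₁ : ℝ) + 1) * P.ℓ k ≤ 89 / 100 * P.r k := by
        have hi' : ((i₁ : ℝ) + 1) ≤ P.S := by exact_mod_cast i₁.2
        calc ((i₁ : ℝ) + 1) * P.ℓ k ≤ (P.S : ℝ) * P.ℓ k := mul_le_mul_of_nonneg_right hi' hℓk.le
          _ = 89 / 100 * P.r k := by
            unfold Params.ℓ Params.wB
            have hS : (0 : ℝ) < P.S := by exact_mod_cast lt_of_lt_of_le (by norm_num) hP.S_le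
            field_simp
      have hiS₂ : ((i₂ : ℝ) + 1) * P.ℓ k ≤ 89 / 100 * P.r k := by
        have hi' : ((i₂ : ℝ) + 1) ≤ P.S := by exact_mod_cast i₂.2
        calc ((i₂ : ℝ) + 1) * P.ℓ k ≤ (P.S : ℝ) * P.ℓ k := mul_le_mul_of_nonneg_right hi' hℓk.le
          _ = 89 / 100 * P.r k := by
            unfold Params.ℓ Params.wB
            have hS : (0 : ℝ) < P.S := by exact_mod_cast lt_of_lt_of_le (by norm_num) hP.S_le
            field_simp
      have hℓs := Params.ℓ_small hP k
      have hclose : |(F.φ F₁.c).1 - (F.φ F₂.c).1| ≤ 2 * P.r k := by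
        rw [abs_lt] at hx
        rw [abs_le]
        have hi0₁ : (0 : ℝ) ≤ i₁ := by positivity
        have hi0₂ : (0 : ℝ) ≤ i₂ := by positivity
        constructor <;> nlinarith
      have h12 : (i₂ : ℕ) ≤ i₁ + 1 :=
        qual_idx_le_of_close hP hk.2 hwf₁ hwf₂ (qual_qualIdx F j F₁ j₁ h₁) (qual_qualIdx F j F₂ j₂ h₂) hclose
      have h21 : (i₁ : ℕ) ≤ i₂ + 1 :=
        qual_idx_le_of_close hP hk.2 hwf₂ hwf₁ (qual_qualIdx F j F₂ j₂ h₂) (qual_qualIdx F j F₁ j₁ h₁)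
          (by rwa [abs_sub_comm])
      have h12' : (i₂ : ℝ) ≤ (i₁ : ℝ) + 1 := by exact_mod_cast h12
      have h21' : (i₁ : ℝ) ≤ (i₂ : ℝ) + 1 := by exact_mod_cast h21
      rw [abs_lt] at hx
      rw [lt_abs] at hx'
      rcases hx' with h | h <;> nlinarith

end Cert


/-! ## §5.6–5.7: compatible configurations, the family `X₀`, shift invariance, and uniform
local aperiodicity (§5.8 via density and Lemma 5.5) -/

variable (P) in
/-- The classes `C = Θ × Σ` (§5.4). [cite: Hochman2025, §5.4] -/
abbrev Cls := Fin P.T × Fin P.S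

namespace Plane

/-- The lattice site `[w] ∈ ℤ²` of a point of the plane (§5.5: "every `w ∈ ℝ²` determines a
site `[w]` obtained by rounding each coordinate"; we round down). [cite: Hochman2025, §5.5] -/
def site (w : ℂ) : ℤ × ℤ := (⌊w.re⌋, ⌊w.im⌋)

/-- Sites of integer translates. [folklore] -/
theorem site_add_intCast (w : ℂ) (v : ℤ × ℤ) :
    site (w + ((v.1 : ℂ) + (v.2 : ℂ) * Complex.I)) = site w + v := by
  simp only [site, Complex.add_re, Complex.add_im, Complex.mul_re, Complex.mul_im,
    Complex.intCast_re, Complex.intCast_im, Complex.I_re, Complex.I_im, mul_zero, mul_one,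
    sub_zero, zero_add, add_zero]
  rw [Int.floor_add_intCast, Int.floor_add_intCast]
  rfl

/-- Nearby points have nearby sites. [folklore] -/
theorem abs_site_sub_le (w : ℂ) (c : ℤ × ℤ) {R : ℝ} {N : ℤ}
    (h : ‖w - ((c.1 : ℂ) + (c.2 : ℂ) * Complex.I)‖ ≤ R) (hN : R + 1 ≤ N) :
    |(site w).1 - c.1| ≤ N ∧ |(site w).2 - c.2| ≤ N := by
  have hre := Complex.abs_re_le_norm (w - ((c.1 : ℂ) + (c.2 : ℂ) * Complex.I))
  have him := Complex.abs_im_le_norm (w - ((c.1 : ℂ) + (c.2 : ℂ) * Complex.I))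
  simp only [Complex.sub_re, Complex.sub_im, Complex.add_re, Complex.add_im, Complex.mul_re,
    Complex.mul_im, Complex.intCast_re, Complex.intCast_im, Complex.I_re, Complex.I_im, mul_zero,
    mul_one, sub_zero, zero_add, add_zero] at hre him
  have h1 := Int.floor_le w.re
  have h2 := Int.lt_floor_add_one w.re
  have h3 := Int.floor_le w.im
  have h4 := Int.lt_floor_add_one w.im
  simp only [site]
  rw [abs_le] at hre him
  constructor
  · have key : (((|⌊w.re⌋ - c.1| : ℤ)) : ℝ) ≤ N := by
      rw [Int.cast_abs]; push_cast; rw [abs_le]; constructor <;> linarith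
    exact_mod_cast key
  · have key : (((|⌊w.im⌋ - c.2| : ℤ)) : ℝ) ≤ N := by
      rw [Int.cast_abs]; push_cast; rw [abs_le]; constructor <;> linarith
    exact_mod_cast key

end Plane

namespace Frame

variable {n : ℕ} (F : Frame P n)

/-- The site of the centre. [folklore] -/
def z : ℤ × ℤ := Plane.site F.c

/-- **The coins of a frame**: its witnesses as (site relative to the site of the centre, class)
pairs. Relative sites make the coin-and-bucket configuration of a frame invariant under
simultaneous integer translation of the certificate and the configuration; two coins in one
bucket still have congruent (absolute) sites and the same class, which is all Lemma 5.5 uses.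
[cite: Hochman2025, §5.6] -/
def coins : Finset ((ℤ × ℤ) × Cls P) :=
  Finset.univ.image fun j => (Plane.site (F.w j) - F.z, (F.k, F.σ j))

/-- Translate a frame by a vector of the plane. [folklore] -/
def translate (d : ℂ) : Frame P n :=
  { c := F.c + d, k := F.k, t := F.t, w := fun j => F.w j + d, σ := F.σ }

/-- Centre of a translate. [folklore] -/
@[simp] theorem translate_c (d : ℂ) : (F.translate d).c = F.c + d := rfl

/-- Orientation index of a translate. [folklore] -/
@[simp] theorem translate_k (d : ℂ) : (F.translate d).k = F.k := rfl

/-- Offsets of a translate. [folklore] -/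
@[simp] theorem translate_t (d : ℂ) : (F.translate d).t = F.t := rfl

/-- Witnesses of a translate. [folklore] -/
@[simp] theorem translate_w (d : ℂ) (j : Fin (P.N n)) : (F.translate d).w j = F.w j + d := rfl

/-- Section indices of a translate. [folklore] -/
@[simp] theorem translate_σ (d : ℂ) : (F.translate d).σ = F.σ := rfl

/-- Orientation vector of a translate. [folklore] -/
@[simp] theorem translate_v (d : ℂ) : (F.translate d).v = F.v := rfl

/-- Frame coordinates are translation invariant. [folklore] -/
@[simp] theorem φ_translate (d p : ℂ) : (F.translate d).φ (p + d) = F.φ p := by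
  simp [Frame.φ, Plane.coords]

/-- Sections translate. [folklore] -/
theorem mem_sect_translate (d : ℂ) (j : Fin (P.N n)) (i : Fin P.S) (p : ℂ) :
    p + d ∈ (F.translate d).sect j i ↔ p ∈ F.sect j i := by
  simp only [Frame.sect, Plane.section_, Set.mem_setOf_eq, translate_v, translate_c, translate_t]
  have : Plane.coords F.v (F.c + d) (p + d) = Plane.coords F.v F.c p := by simp [Plane.coords]
  rw [this]

/-- Doubled sections translate. [folklore] -/
theorem mem_sect2_translate (d : ℂ) (j : Fin (P.N n)) (i : Fin P.S) (p : ℂ) :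
    p + d ∈ (F.translate d).sect2 j i ↔ p ∈ F.sect2 j i := by
  simp only [Frame.sect2, Plane.section2, Set.mem_setOf_eq, translate_v, translate_c, translate_t]
  have : Plane.coords F.v (F.c + d) (p + d) = Plane.coords F.v F.c p := by simp [Plane.coords]
  rw [this]

/-- Well-formedness is translation invariant. [folklore] -/
theorem WF.translate {F : Frame P n} (hF : F.WF) (d : ℂ) : (F.translate d).WF where
  band := hF.band
  apart := hF.apart
  wit j := by
    have := hF.wit j
    change F.w j + d ∈ (F.translate d).sect j ((F.translate d).σ j)
    rw [translate_σ, mem_sect_translate]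
    exact this

/-- The coins of an integer translate are the same. [folklore] -/
theorem coins_translate_int (v : ℤ × ℤ) :
    (F.translate ((v.1 : ℂ) + (v.2 : ℂ) * Complex.I)).coins = F.coins := by
  unfold coins
  congr 1
  funext j
  simp only [translate_w, translate_k, translate_σ, Frame.z, translate_c, Plane.site_add_intCast]
  congr 1
  abel

/-- The site of the centre of an integer translate. [folklore] -/
theorem z_translate_int (v : ℤ × ℤ) :
    (F.translate ((v.1 : ℂ) + (v.2 : ℂ) * Complex.I)).z = F.z + v := by
  simp [Frame.z, Plane.site_add_intCast]

end Frame

variable (P) in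
/-- The enumeration of the buckets `(ℤ/nℤ)² × C` of a level-`n` frame by `Fin (buckets n)`.
[cite: Hochman2025, §5.6] -/
def bucketsEquiv (n : ℕ) [NeZero n] : (ZMod n × ZMod n) × Cls P ≃ Fin (P.buckets n) :=
  Fintype.equivFinOfCardEq (by simp [Params.buckets, ZMod.card, Fintype.card_prod]; ring)

/-- **`CBC(x, F)`** (§5.6): the coin-and-bucket configuration of a frame in a configuration `x`
(one Boolean layer per class), read from the centre of the frame. [cite: Hochman2025, §5.6] -/
def Frame.cbcF {n : ℕ} [NeZero n] (x : ℤ × ℤ → Cls P → Bool) (F : Frame P n) :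
    CoinsAndBuckets.Config (P.buckets n) :=
  cbc (bucketsEquiv P n) (fun s => x (s + F.z)) F.coins

namespace Cert

/-- **`x` is compatible with `C`** (§5.6): `CBC(x, F)` is unorientable for every frame of every
level `n ≥ 1`. [cite: Hochman2025, §5.6] -/
def Compat (x : ℤ × ℤ → Cls P → Bool) (C' : Cert P) : Prop :=
  ∀ n : ℕ, ∀ F ∈ C'.frames (n + 1), CoinsAndBuckets.IsUnorientable (F.cbcF x)

/-- Translate a certificate. [folklore] -/
def translate (C' : Cert P) (d : ℂ) : Cert P where
  frames n := (fun F => F.translate d) '' C'.frames n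

end Cert

/-- **The family `X₀`** (§5.7): configurations (one Boolean layer per class) admitting a dense
valid certificate with which they are compatible. [cite: Hochman2025, §5.7] -/
def X0 (P : Params) (hP : P.Good) : Set (ℤ × ℤ → Cls P → Bool) :=
  {x | ∃ C : Cert P, C.Valid hP ∧ C.Dense ∧ C.Compat x}


/-! ### Translation invariance of validity, density and compatibility; shift invariance of `X₀` -/

namespace Frame

variable {n : ℕ}

/-- Translation of frames is injective. [folklore] -/
theorem translate_injective (d : ℂ) : Function.Injective fun F : Frame P n => F.translate d := by
  intro F G h
  have h' : F.translate d = G.translate d := h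
  obtain ⟨c, k, t, w, σ⟩ := F
  obtain ⟨c', k', t', w', σ'⟩ := G
  simp only [Frame.translate, Frame.mk.injEq, add_left_inj] at h'
  obtain ⟨hc, hk, ht, hw, hσ⟩ := h'
  have hw' : w = w' := by
    funext j
    have := congrFun hw j
    simpa using this
  subst hc; subst hk; subst ht; subst hσ; subst hw'
  rfl

end Frame

namespace Cert

variable {C : Cert P}

/-- Membership in the frames of a translate. [folklore] -/
theorem mem_translate_frames {d : ℂ} {n : ℕ} {G : Frame P n} :
    G ∈ (C.translate d).frames n ↔ ∃ F ∈ C.frames n, F.translate d = G := Iff.rfl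

/-- Qualification is translation invariant. [folklore] -/
theorem qual_translate_iff {n k : ℕ} (F : Frame P n) (j : Fin (P.N n)) (F' : Frame P k)
    (j' : Fin (P.N k)) (i : Fin P.S) (d : ℂ) :
    Qual (F.translate d) j (F'.translate d) j' i ↔ Qual F j F' j' i := by
  unfold Qual
  constructor
  · rintro ⟨p, hp1, hp2⟩
    refine ⟨p - d, ?_, ?_⟩
    · rw [← Frame.mem_sect2_translate F' d]; simpa using hp1
    · rw [← Frame.mem_sect_translate F d]; simpa using hp2
  · rintro ⟨p, hp1, hp2⟩
    exact ⟨p + d, (Frame.mem_sect2_translate F' d j' i p).mpr hp1,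
      (Frame.mem_sect_translate F d j i p).mpr hp2⟩

/-- The least qualifying index only depends on the qualification predicate. [folklore] -/
theorem qualIdx_congr {n k n₂ k₂ : ℕ} {F : Frame P n} {j : Fin (P.N n)} {F' : Frame P k}
    {j' : Fin (P.N k)} {G : Frame P n₂} {i : Fin (P.N n₂)} {G' : Frame P k₂} {i' : Fin (P.N k₂)}
    (hiff : ∀ s, Qual F j F' j' s ↔ Qual G i G' i' s) (h : ∃ s, Qual F j F' j' s)
    (h' : ∃ s, Qual G i G' i' s) : qualIdx F j F' j' h = qualIdx G i G' i' h' := by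
  classical
  unfold qualIdx
  congr 1
  · ext s; simp [hiff]

/-- **The obstacle family is translation invariant** (in frame coordinates nothing moves).
[folklore] -/
theorem familySet_translate (d : ℂ) {n : ℕ} (F : Frame P n) (j : Fin (P.N n)) :
    (C.translate d).familySet (F.translate d) j = C.familySet F j := by
  have hstrip : stripDiamonds (F.translate d) j = stripDiamonds F j := rfl
  have hdd : ∀ {k : ℕ} (F' : Frame P k) (j' : Fin (P.N k)) (i₀ : Fin P.S),
      ddDiamond (F.translate d) (F'.translate d) j' i₀ = ddDiamond F F' j' i₀ := by
    intro k F' j' i₀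
    simp only [ddDiamond, Frame.translate_t, Frame.translate_c, Frame.φ_translate]
  ext D
  simp only [familySet, Set.mem_union, Finset.mem_coe, hstrip]
  apply or_congr_right
  constructor
  · rintro ⟨k, hk, G', hG', hkk, j', h, rfl⟩
    obtain ⟨F', hF', rfl⟩ := mem_translate_frames.mp hG'
    have h' : ∃ s, Qual F j F' j' s := by
      obtain ⟨s, hs⟩ := h; exact ⟨s, (qual_translate_iff F j F' j' s d).mp hs⟩
    refine ⟨k, hk, F', hF', hkk, j', h', ?_⟩
    rw [hdd, qualIdx_congr (fun s => qual_translate_iff F j F' j' s d) h h']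
  · rintro ⟨k, hk, F', hF', hkk, j', h, rfl⟩
    have h' : ∃ s, Qual (F.translate d) j (F'.translate d) j' s := by
      obtain ⟨s, hs⟩ := h; exact ⟨s, (qual_translate_iff F j F' j' s d).mpr hs⟩
    refine ⟨k, hk, F'.translate d, ⟨F', hF', rfl⟩, hkk, j', h', ?_⟩
    rw [hdd, qualIdx_congr (fun s => qual_translate_iff F j F' j' s d) h' h]

/-- Well-formedness is translation invariant. [folklore] -/
theorem WF.translate (hC : C.WF) (d : ℂ) : (C.translate d).WF where
  frame n G hG := by
    obtain ⟨F, hF, rfl⟩ := mem_translate_frames.mp hG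
    exact (hC.frame n F hF).translate d
  sep n G hG G' hG' hne := by
    obtain ⟨F, hF, rfl⟩ := mem_translate_frames.mp hG
    obtain ⟨F', hF', rfl⟩ := mem_translate_frames.mp hG'
    have hne' : F ≠ F' := fun h => hne (by rw [h])
    simpa using hC.sep n F hF F' hF' hne'

/-- Safety of witnesses is translation invariant. [folklore] -/
theorem WitSafe.translate {hP : P.Good} (hC : C.WitSafe hP) (d : ℂ) : (C.translate d).WitSafe hP := by
  intro n hn G hG j 𝔉 h𝔉
  obtain ⟨F, hF, rfl⟩ := mem_translate_frames.mp hG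
  rw [familySet_translate] at h𝔉
  have := hC n hn F hF j 𝔉 h𝔉
  simpa [Frame.translate_w, Frame.φ_translate] using this

/-- Validity is translation invariant. [folklore] -/
theorem Valid.translate {hP : P.Good} (hC : C.Valid hP) (d : ℂ) : (C.translate d).Valid hP :=
  ⟨hC.wf.translate d, hC.safe.translate d⟩

/-- Density is translation invariant. [folklore] -/
theorem Dense.translate (hC : C.Dense) (d : ℂ) : (C.translate d).Dense := by
  intro n hn p
  obtain ⟨F, hF, hd⟩ := hC n hn (p - d)
  refine ⟨F.translate d, ⟨F, hF, rfl⟩, ?_⟩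
  simpa [sub_sub, add_comm] using hd

/-- **Compatibility is covariant under integer translations**: translating the certificate by
`-u` and the configuration by `shift u` preserves the coin-and-bucket configuration of every
frame (read from its centre). [cite: Hochman2025, §5.7 ("`X` is closed and shift-invariant")] -/
theorem Compat.translate {x : ℤ × ℤ → Cls P → Bool} (hC : C.Compat x) (u : ℤ × ℤ) :
    (C.translate (((-u).1 : ℂ) + ((-u).2 : ℂ) * Complex.I)).Compat (shift u x) := by
  intro n G hG
  obtain ⟨F, hF, rfl⟩ := mem_translate_frames.mp hG
  have hcb : (F.translate (((-u).1 : ℂ) + ((-u).2 : ℂ) * Complex.I)).cbcF (shift u x) = F.cbcF x := by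
    unfold Frame.cbcF
    rw [Frame.coins_translate_int, Frame.z_translate_int]
    refine cbc_congr _ fun w _ => ?_
    simp only [shift_apply]
    congr 1
    abel
  rw [hcb]
  exact hC n F hF

end Cert

/-- **`X₀` is shift invariant** (§5.7). [cite: Hochman2025, §5.7] -/
theorem isShiftInvariant_X0 (hP : P.Good) : IsShiftInvariant (X0 P hP) := by
  intro u x hx
  obtain ⟨C, hV, hD, hc⟩ := hx
  exact ⟨C.translate _, hV.translate _, hD.translate _, hc.translate u⟩

/-! ### Uniform local aperiodicity of `X₀` (Lemma 5.5 with dense levels; cf. Lemma 5.7) -/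

/-- Coins come from witnesses. [folklore] -/
theorem Frame.mem_coins_iff {n : ℕ} (F : Frame P n) {u : (ℤ × ℤ) × Cls P} :
    u ∈ F.coins ↔ ∃ j, (Plane.site (F.w j) - F.z, (F.k, F.σ j)) = u := by
  simp [Frame.coins]

/-- **`X₀` is uniformly locally aperiodic**: by density every point of the plane is within
`10 rₙ` of the centre of a level-`n` frame, whose witnesses are within `11 rₙ`; the frame is
compatible, so by Lemma 5.5 two of its witnesses of the same class have congruent sites
modulo `n` and different symbols. [cite: Hochman2025, Lemma 5.5 and Lemma 5.7] -/
theorem isUniformlyLocallyAperiodic_X0 (hP : P.Good) : IsUniformlyLocallyAperiodic (X0 P hP) := by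
  intro n hn
  refine ⟨⌈11 * P.r n⌉₊ + 1, ?_⟩
  intro x hx c
  obtain ⟨C, hV, hD, hc⟩ := hx
  obtain ⟨m, rfl⟩ : ∃ m, n = m + 1 := ⟨n - 1, by omega⟩
  set p : ℂ := (c.1 : ℂ) + (c.2 : ℂ) * Complex.I with hp
  obtain ⟨F, hF, hdist⟩ := hD (m + 1) hn p
  have hU := hc m F hF
  obtain ⟨u, hu, v, hv, h1, h2, hne⟩ :=
    exists_pair_of_isUnorientable (bucketsEquiv P (m + 1)) (fun s => x (s + F.z)) F.coins hU
  obtain ⟨ju, rfl⟩ := F.mem_coins_iff.mp hu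
  obtain ⟨jv, rfl⟩ := F.mem_coins_iff.mp hv
  simp only at h1 h2 hne
  refine ⟨Plane.site (F.w ju), Plane.site (F.w jv), ?_⟩
  -- distances
  have hwf := hV.wf.frame (m + 1) F hF
  have hwit : ∀ j, ‖F.w j - p‖ ≤ 11 * P.r (m + 1) := by
    intro j
    have h1 : F.w j ∈ F.disk := hwf.box_subset_disk F j (hwf.w_mem_box F (lt_of_lt_of_le (by norm_num) hP.S_le) j)
    rw [Frame.disk, Metric.mem_closedBall, Complex.dist_eq] at h1
    calc ‖F.w j - p‖ = ‖(F.w j - F.c) + (F.c - p)‖ := by ring_nf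
      _ ≤ ‖F.w j - F.c‖ + ‖F.c - p‖ := norm_add_le _ _
      _ ≤ 11 * P.r (m + 1) := by rw [norm_sub_rev F.c p]; linarith
  have hN : 11 * P.r (m + 1) + 1 ≤ ((⌈11 * P.r (m + 1)⌉₊ + 1 : ℕ) : ℤ) := by
    push_cast
    linarith [Nat.le_ceil (11 * P.r (m + 1))]
  obtain ⟨bu1, bu2⟩ := Plane.abs_site_sub_le (F.w ju) c (hwit ju) hN
  obtain ⟨bv1, bv2⟩ := Plane.abs_site_sub_le (F.w jv) c (hwit jv) hN
  refine ⟨bu1, bu2, bv1, bv2, ?_, ?_, ?_⟩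
  · simpa using h1
  · simpa using h2
  · simpa [sub_add_cancel] using hne


/-! ## §5.8 (Lemma 5.8): a dense valid certificate and a compatible configuration exist

The standard certificate: at every level `n ≥ 1` one frame centred at each point of the
lattice `10 rₙ ℤ[i]`, all with orientation index `0` (`v = 1`), boxes at transverse offsets
`t_j = 101 hₙ j`, every witness in section `0` of its box. The geometry is explicit; the
witnesses are then chosen as safe points of the (geometry-determined) obstacle families using
Prop. 4.1 (2) (`SafePoints.prop_4_1`), and a compatible configuration is obtained by showing,
in each frame, heads on exactly `2^k` of the `≥ 2^{k+1}` coins of a fullest bucket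
(`CoinsAndBuckets.not_isOriented_of_big_bucket`); distinct coins occupy distinct sites by
Cor. 5.3, so these prescriptions are simultaneously realizable. -/

namespace Std


/-- Orientation index `0`. [folklore] -/
def k0 (hP : P.Good) : Fin P.T := ⟨0, lt_of_lt_of_le (by norm_num) hP.T_le⟩

/-- Section index `0`. [folklore] -/
def i0 (hP : P.Good) : Fin P.S := ⟨0, lt_of_lt_of_le (by norm_num) hP.S_le⟩

/-- Centre of the frame `(a, b)` of level `n`: the lattice point `10 rₙ (a + b i)`. [folklore] -/
def ctr (n : ℕ) (ab : ℤ × ℤ) : ℂ := (10 * P.r n * ab.1 : ℝ) + (10 * P.r n * ab.2 : ℝ) * Complex.I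

/-- Transverse offsets `t_j = 101 hₙ j`. [folklore] -/
def off (n : ℕ) (j : Fin (P.N n)) : ℝ := 101 * P.h n * j

/-- First frame coordinate of the standard witnesses: the middle of section `0`. [folklore] -/
def x0 (n : ℕ) : ℝ := -(P.r n / 10) - P.ℓ n / 2

/-- Transverse coordinate of the provisional witnesses (mid-height of the box). [folklore] -/
def ymid (n : ℕ) (j : Fin (P.N n)) : ℝ := off (P := P) n j + P.h n / 2

/-- The point with frame coordinates `(x, y)` in a frame of orientation `1` centred at `c`.
[folklore] -/
def pt (c : ℂ) (x y : ℝ) : ℂ := c + ((x : ℂ) + (y : ℂ) * Complex.I)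

/-- The skeleton frame `(a, b)` of level `n`, with provisional witnesses at mid-height of
section `0` (only its geometry matters). [folklore] -/
def skel (hP : P.Good) (n : ℕ) (ab : ℤ × ℤ) : Frame P n where
  c := ctr (P := P) n ab
  k := k0 hP
  t := off (P := P) n
  w j := pt (ctr (P := P) n ab) (x0 (P := P) n) (ymid (P := P) n j)
  σ _ := i0 hP

/-- The skeleton certificate. [folklore] -/
def skelCert (hP : P.Good) : Cert P where
  frames n := if n = 0 then ∅ else Set.range (skel hP n)


/-- The orientation of the standard frames is `1`. [folklore] -/
theorem skel_v {hP : P.Good} (n : ℕ) (ab : ℤ × ℤ) : (skel hP n ab).v = 1 := by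
  simp [Frame.v, skel, k0, Plane.orient]

/-- Frame coordinates in a frame of orientation `1` are real and imaginary parts. [folklore] -/
@[simp] theorem coords_pt (c : ℂ) (x y : ℝ) : Plane.coords 1 c (pt c x y) = (x, y) := by
  simp [Plane.coords, pt]

/-- The offsets fit in the band. [folklore] -/
theorem off_band (hP : P.Good) (n : ℕ) (j : Fin (P.N n)) :
    0 ≤ off (P := P) n j ∧ off (P := P) n j + 101 * P.h n ≤ P.r n / 100 := by
  have hh := P.h_pos n
  have hfit := hP.boxes_fit n
  have hj : ((j : ℕ) : ℝ) + 1 ≤ P.N n := by exact_mod_cast j.2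
  unfold off
  constructor
  · positivity
  · nlinarith

/-- The skeleton frames are well formed. [folklore] -/
theorem skel_wf (hP : P.Good) (n : ℕ) (ab : ℤ × ℤ) : (skel hP n ab).WF where
  band j := by
    obtain ⟨h1, h2⟩ := off_band hP n j
    have hh := P.h_pos n
    have hr := P.r_pos n
    change |off n j| ≤ _ ∧ |off n j + P.h n| ≤ _
    rw [abs_of_nonneg h1, abs_of_nonneg (by linarith)]
    constructor <;> linarith
  apart j j' hjj' := by
    change 101 * P.h n ≤ |off n j - off n j'|
    unfold off
    have hh := P.h_pos n
    rw [← mul_sub, abs_mul, abs_of_pos (by positivity)]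
    have : (1 : ℝ) ≤ |((j : ℕ) : ℝ) - ((j' : ℕ) : ℝ)| := by
      have hne : (j : ℕ) ≠ (j' : ℕ) := fun h => hjj' (Fin.ext h)
      rcases Nat.lt_or_gt_of_ne hne with h | h
      · have : ((j : ℕ) : ℝ) + 1 ≤ ((j' : ℕ) : ℝ) := by exact_mod_cast h
        rw [abs_of_neg (by linarith)]; linarith
      · have : ((j' : ℕ) : ℝ) + 1 ≤ ((j : ℕ) : ℝ) := by exact_mod_cast h
        rw [abs_of_pos (by linarith)]; linarith
    nlinarith
  wit j := by
    change (skel hP n ab).w j ∈ Plane.section_ (skel hP n ab).v (skel hP n ab).c (P.r n) (P.h n)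
      ((skel hP n ab).t j) P.S ((skel hP n ab).σ j)
    rw [skel_v]
    simp only [skel, Plane.section_, Set.mem_setOf_eq, i0, coords_pt]
    have hℓ : 89 / 100 * P.r n / P.S = P.ℓ n := rfl
    simp only [hℓ, x0, ymid, Nat.cast_zero, zero_add, one_mul, zero_mul, sub_zero]
    have := Params.ℓ_pos hP n
    have hh := P.h_pos n
    refine ⟨by linarith, by linarith, by linarith, by linarith⟩

/-- Distinct lattice points are `≥ 10 r` apart. [folklore] -/
theorem norm_ctr_sub_ctr (n : ℕ) {ab ab' : ℤ × ℤ} (h : ab ≠ ab') :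
    10 * P.r n ≤ ‖ctr (P := P) n ab - ctr (P := P) n ab'‖ := by
  have hr := P.r_pos n
  have hre : (ctr (P := P) n ab - ctr (P := P) n ab').re = 10 * P.r n * (ab.1 - ab'.1 : ℤ) := by
    simp [ctr]; ring
  have him : (ctr (P := P) n ab - ctr (P := P) n ab').im = 10 * P.r n * (ab.2 - ab'.2 : ℤ) := by
    simp [ctr]; ring
  have h1 := Complex.abs_re_le_norm (ctr (P := P) n ab - ctr (P := P) n ab')
  have h2 := Complex.abs_im_le_norm (ctr (P := P) n ab - ctr (P := P) n ab')
  rw [hre] at h1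
  rw [him] at h2
  by_cases ha : ab.1 = ab'.1
  · have hb : ab.2 ≠ ab'.2 := fun hb => h (Prod.ext ha hb)
    have : (1 : ℝ) ≤ |((ab.2 - ab'.2 : ℤ) : ℝ)| := by
      rw [← Int.cast_abs]; exact_mod_cast Int.one_le_abs (sub_ne_zero.mpr hb)
    rw [abs_mul, abs_of_pos (by positivity)] at h2
    nlinarith
  · have : (1 : ℝ) ≤ |((ab.1 - ab'.1 : ℤ) : ℝ)| := by
      rw [← Int.cast_abs]; exact_mod_cast Int.one_le_abs (sub_ne_zero.mpr ha)
    rw [abs_mul, abs_of_pos (by positivity)] at h1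
    nlinarith

/-- `skel` is injective in the lattice index. [folklore] -/
theorem skel_injective {hP : P.Good} (n : ℕ) : Function.Injective (skel hP n) := by
  intro ab ab' h
  by_contra hne
  have := norm_ctr_sub_ctr (P := P) n hne
  have hc : (skel hP n ab).c = (skel hP n ab').c := by rw [h]
  change ctr n ab = ctr n ab' at hc
  rw [hc, sub_self, norm_zero] at this
  linarith [P.r_pos n]

/-- Membership in the skeleton certificate. [folklore] -/
theorem mem_skelCert {hP : P.Good} {n : ℕ} {F : Frame P n} :
    F ∈ (skelCert hP).frames n ↔ n ≠ 0 ∧ ∃ ab, skel hP n ab = F := by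
  change F ∈ (if n = 0 then (∅ : Set (Frame P n)) else Set.range (skel hP n)) ↔ _
  split_ifs with h
  · simp [h]
  · simp [h]

/-- The skeleton certificate is well formed. [folklore] -/
theorem skelCert_wf (hP : P.Good) : (skelCert hP).WF where
  frame n F hF := by
    obtain ⟨-, ab, rfl⟩ := mem_skelCert.mp hF
    exact skel_wf hP n ab
  sep n F hF F' hF' hne := by
    obtain ⟨-, ab, rfl⟩ := mem_skelCert.mp hF
    obtain ⟨-, ab', rfl⟩ := mem_skelCert.mp hF'
    have hab : ab ≠ ab' := fun h => hne (by rw [h])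
    have := norm_ctr_sub_ctr (P := P) n hab
    change P.r n / 2 ≤ ‖ctr n ab - ctr n ab'‖
    linarith [P.r_pos n]

/-- Every point is within `10 r` of a lattice point (round both coordinates). [folklore] -/
theorem exists_ctr_near (n : ℕ) (p : ℂ) : ∃ ab : ℤ × ℤ, ‖p - ctr (P := P) n ab‖ ≤ 10 * P.r n := by
  have hr := P.r_pos n
  set L := 10 * P.r n with hL
  have hL0 : 0 < L := by positivity
  refine ⟨(round (p.re / L), round (p.im / L)), ?_⟩
  have h1 := abs_sub_round (p.re / L)
  have h2 := abs_sub_round (p.im / L)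
  have e1 : p.re - L * round (p.re / L) = L * (p.re / L - round (p.re / L)) := by field_simp
  have e2 : p.im - L * round (p.im / L) = L * (p.im / L - round (p.im / L)) := by field_simp
  have hre : |(p - ctr (P := P) n (round (p.re / L), round (p.im / L))).re| ≤ L / 2 := by
    have : (p - ctr (P := P) n (round (p.re / L), round (p.im / L))).re = p.re - L * round (p.re / L) := by
      simp [ctr, hL]
    rw [this, e1, abs_mul, abs_of_pos hL0]
    nlinarith
  have him : |(p - ctr (P := P) n (round (p.re / L), round (p.im / L))).im| ≤ L / 2 := by
    have : (p - ctr (P := P) n (round (p.re / L), round (p.im / L))).im = p.im - L * round (p.im / L) := by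
      simp [ctr, hL]
    rw [this, e2, abs_mul, abs_of_pos hL0]
    nlinarith
  have := Complex.norm_le_abs_re_add_abs_im (p - ctr (P := P) n (round (p.re / L), round (p.im / L)))
  linarith

end Std


namespace Cert

variable {C : Cert P}

/-- Level indices of the members of the family of a level-`n` box are `≤ n - 1`. [folklore] -/
theorem familySet_level_le {n : ℕ} (F : Frame P n) (j : Fin (P.N n)) {D : SafePoints.Diamond}
    (hD : D ∈ C.familySet F j) : D.n ≤ n - 1 := by
  rcases hD with hD | ⟨k, hk, F', -, -, j', h, rfl⟩
  · simp only [stripDiamonds, Finset.coe_insert, Finset.coe_singleton, Set.mem_insert_iff,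
      Set.mem_singleton_iff] at hD
    rcases hD with rfl | rfl <;> exact le_rfl
  · change k - 1 ≤ n - 1; omega

/-- **Safe points exist in every section of every box of a well-formed certificate**, indeed on
every transverse segment of length `0.08 hₙ` (Prop. 4.1 (2) for the sparse obstacle family).
[cite: Hochman2025, Prop 4.1 (2) and Lemma 5.8] -/
theorem exists_safe_on_segment (hP : P.Good) (hC : C.WF) {n : ℕ} (hn : 1 ≤ n) (F : Frame P n)
    (j : Fin (P.N n)) (𝔉 : Finset SafePoints.Diamond)
    (h𝔉 : (↑𝔉 : Set SafePoints.Diamond) = C.familySet F j) (x u : ℝ) :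
    ∃ y ∈ Icc u (u + 8 / 100 * P.h n), (x, y) ∈ SafePoints.safe (P.famScales hP n) 𝔉 := by
  set ρ := SafePoints.RectScales.ofScales (P.famScales hP n) with hρ
  have hρσ : ρ.toScales = P.famScales hP n := SafePoints.RectScales.toScales_ofScales _
  have hgood : ρ.toScales.Good 10 := by rw [hρσ]; exact Params.famScales_good hP n
  have hsp : SafePoints.RectSparse ρ 𝔉 := familySet_rectSparse hP hC hn F j 𝔉 h𝔉
  obtain ⟨-, h2, -, -⟩ := SafePoints.prop_4_1 hgood hsp
  have hlev : ∀ D ∈ 𝔉, D.n ≤ n - 1 := by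
    intro D hD
    exact familySet_level_le F j (by rw [← h𝔉]; exact hD)
  obtain ⟨y, hy, hsafe⟩ := h2 (n - 1) hlev x u
  have hh : ρ.h (n - 1) = P.h n / 100 := by
    simp only [hρ, SafePoints.RectScales.ofScales]
    unfold Params.famScales
    rw [SafePoints.Scales.extendScales_b_of_lt _ (by omega : n - 1 < n)]
    unfold Params.famB
    rw [if_neg (by omega)]
    ring
  rw [hh] at hy
  rw [hρσ] at hsafe
  refine ⟨y, ?_, hsafe⟩
  simpa [show u + 8 * (P.h n / 100) = u + 8 / 100 * P.h n by ring] using hy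

/-- Geometric agreement of two frames (same centre, orientation index and offsets): all that
the obstacle families see. [folklore] -/
def SameGeom {n : ℕ} (F G : Frame P n) : Prop := F.c = G.c ∧ F.k = G.k ∧ F.t = G.t

/-- Sections only depend on the geometry. [folklore] -/
theorem SameGeom.sect_eq {n : ℕ} {F G : Frame P n} (h : SameGeom F G) (j : Fin (P.N n)) (i : Fin P.S) :
    F.sect j i = G.sect j i := by
  obtain ⟨hc, hk, ht⟩ := h
  simp only [Frame.sect, Frame.v, hc, hk, ht]

/-- Doubled sections only depend on the geometry. [folklore] -/
theorem SameGeom.sect2_eq {n : ℕ} {F G : Frame P n} (h : SameGeom F G) (j : Fin (P.N n)) (i : Fin P.S) :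
    F.sect2 j i = G.sect2 j i := by
  obtain ⟨hc, hk, ht⟩ := h
  simp only [Frame.sect2, Frame.v, hc, hk, ht]

/-- Frame coordinates only depend on the geometry. [folklore] -/
theorem SameGeom.φ_eq {n : ℕ} {F G : Frame P n} (h : SameGeom F G) : F.φ = G.φ := by
  obtain ⟨hc, hk, -⟩ := h
  funext p
  simp only [Frame.φ, Frame.v, hc, hk]

/-- **The obstacle family only depends on the geometry of the certificate.** [folklore] -/
theorem familySet_congr {C₀ C₁ : Cert P}
    (h01 : ∀ k (G₀ : Frame P k), G₀ ∈ C₀.frames k → ∃ G₁ ∈ C₁.frames k, SameGeom G₀ G₁)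
    (h10 : ∀ k (G₁ : Frame P k), G₁ ∈ C₁.frames k → ∃ G₀ ∈ C₀.frames k, SameGeom G₀ G₁)
    {n : ℕ} {F₀ F₁ : Frame P n} (hF : SameGeom F₀ F₁) (j : Fin (P.N n)) :
    C₁.familySet F₁ j = C₀.familySet F₀ j := by
  have hstrip : stripDiamonds F₁ j = stripDiamonds F₀ j := by
    obtain ⟨-, -, ht⟩ := hF
    simp only [stripDiamonds, stripLo, stripHi, ht]
  have hqual : ∀ {k : ℕ} {G₀ G₁ : Frame P k} (hG : SameGeom G₀ G₁) (j' : Fin (P.N k)) (i : Fin P.S),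
      Qual F₁ j G₁ j' i ↔ Qual F₀ j G₀ j' i := by
    intro k G₀ G₁ hG j' i
    unfold Qual
    rw [hG.sect2_eq, hF.sect_eq]
  have hdd : ∀ {k : ℕ} {G₀ G₁ : Frame P k} (hG : SameGeom G₀ G₁) (j' : Fin (P.N k)) (i₀ : Fin P.S),
      ddDiamond F₁ G₁ j' i₀ = ddDiamond F₀ G₀ j' i₀ := by
    intro k G₀ G₁ hG j' i₀
    obtain ⟨hc, -, ht⟩ := hG
    simp only [ddDiamond, hF.φ_eq, hc, ht]
  ext D
  simp only [familySet, Set.mem_union, Finset.mem_coe, hstrip]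
  apply or_congr_right
  constructor
  · rintro ⟨k, hk, G₁, hG₁, hkk, j', h, rfl⟩
    obtain ⟨G₀, hG₀, hG⟩ := h10 k G₁ hG₁
    have h' : ∃ s, Qual F₀ j G₀ j' s := by
      obtain ⟨s, hs⟩ := h; exact ⟨s, (hqual hG j' s).mp hs⟩
    refine ⟨k, hk, G₀, hG₀, by rw [hG.2.1, hkk, hF.2.1], j', h', ?_⟩
    rw [hdd hG, qualIdx_congr (fun s => hqual hG j' s) h h']
  · rintro ⟨k, hk, G₀, hG₀, hkk, j', h, rfl⟩
    obtain ⟨G₁, hG₁, hG⟩ := h01 k G₀ hG₀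
    have h' : ∃ s, Qual F₁ j G₁ j' s := by
      obtain ⟨s, hs⟩ := h; exact ⟨s, (hqual hG j' s).mpr hs⟩
    refine ⟨k, hk, G₁, hG₁, by rw [← hG.2.1, hkk, hF.2.1], j', h', ?_⟩
    rw [hdd hG, qualIdx_congr (fun s => hqual hG j' s) h' h]

end Cert

namespace Std


/-- The finite obstacle family of box `j` of the skeleton frame `(a, b)` of level `n`. [folklore] -/
def fam (hP : P.Good) (n : ℕ) (ab : ℤ × ℤ) (j : Fin (P.N n)) : Finset SafePoints.Diamond :=
  if h : n = 0 then ∅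
  else (Cert.familySet_finite hP (skelCert_wf hP) (n := n) (F := skel hP n ab)
    (mem_skelCert.mpr ⟨h, ab, rfl⟩) j).toFinset

/-- `fam` enumerates the family. [folklore] -/
theorem coe_fam (hP : P.Good) {n : ℕ} (hn : n ≠ 0) (ab : ℤ × ℤ) (j : Fin (P.N n)) :
    (↑(fam hP n ab j) : Set SafePoints.Diamond) = (skelCert hP).familySet (skel hP n ab) j := by
  simp [fam, hn]

/-- Existence of the standard witnesses: a safe transverse coordinate in
`[t_j + hₙ/10, t_j + 0.18 hₙ]` at the middle of section `0`. [cite: Hochman2025, Lemma 5.8] -/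
theorem exists_wy (hP : P.Good) {n : ℕ} (hn : n ≠ 0) (ab : ℤ × ℤ) (j : Fin (P.N n)) :
    ∃ y ∈ Icc (off (P := P) n j + P.h n / 10) (off (P := P) n j + P.h n / 10 + 8 / 100 * P.h n),
      (x0 (P := P) n, y) ∈ SafePoints.safe (P.famScales hP n) (fam hP n ab j) :=
  Cert.exists_safe_on_segment hP (skelCert_wf hP) (Nat.one_le_iff_ne_zero.mpr hn) (skel hP n ab) j
    (fam hP n ab j) (coe_fam hP hn ab j) _ _

/-- The transverse coordinate of the standard witness of box `j` of frame `(a, b)` of level `n`.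
[folklore] -/
def wy (hP : P.Good) (n : ℕ) (ab : ℤ × ℤ) (j : Fin (P.N n)) : ℝ :=
  if hn : n = 0 then 0 else Classical.choose (exists_wy hP hn ab j)

/-- The defining property of `wy`. [folklore] -/
theorem wy_spec (hP : P.Good) {n : ℕ} (hn : n ≠ 0) (ab : ℤ × ℤ) (j : Fin (P.N n)) :
    wy hP n ab j ∈ Icc (off (P := P) n j + P.h n / 10) (off (P := P) n j + P.h n / 10 + 8 / 100 * P.h n) ∧
      (x0 (P := P) n, wy hP n ab j) ∈ SafePoints.safe (P.famScales hP n) (fam hP n ab j) := by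
  simp only [wy, hn, dif_neg, not_false_eq_true]
  exact Classical.choose_spec (exists_wy hP hn ab j)

/-- **The standard frame** `(a, b)` of level `n`: the skeleton with its witnesses moved to safe
points of section `0`. [cite: Hochman2025, Lemma 5.8] -/
def full (hP : P.Good) (n : ℕ) (ab : ℤ × ℤ) : Frame P n where
  c := ctr (P := P) n ab
  k := k0 hP
  t := off (P := P) n
  w j := pt (ctr (P := P) n ab) (x0 (P := P) n) (wy hP n ab j)
  σ _ := i0 hP

/-- **The standard certificate.** [cite: Hochman2025, Lemma 5.8] -/
def stdCert (hP : P.Good) : Cert P where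
  frames n := if n = 0 then ∅ else Set.range (full hP n)


/-- Membership in the standard certificate. [folklore] -/
theorem mem_stdCert {hP : P.Good} {n : ℕ} {F : Frame P n} :
    F ∈ (stdCert hP).frames n ↔ n ≠ 0 ∧ ∃ ab, full hP n ab = F := by
  change F ∈ (if n = 0 then (∅ : Set (Frame P n)) else Set.range (full hP n)) ↔ _
  split_ifs with h
  · simp [h]
  · simp [h]

/-- Skeleton and standard frames have the same geometry. [folklore] -/
theorem sameGeom_skel_full {hP : P.Good} (n : ℕ) (ab : ℤ × ℤ) : Cert.SameGeom (skel hP n ab) (full hP n ab) :=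
  ⟨rfl, rfl, rfl⟩

/-- The orientation of the standard frames is `1`. [folklore] -/
theorem full_v {hP : P.Good} (n : ℕ) (ab : ℤ × ℤ) : (full hP n ab).v = 1 := by
  simp [Frame.v, full, k0, Plane.orient]

/-- The standard frames are well formed. [folklore] -/
theorem full_wf (hP : P.Good) {n : ℕ} (hn : n ≠ 0) (ab : ℤ × ℤ) : (full hP n ab).WF where
  band := (skel_wf hP n ab).band
  apart := (skel_wf hP n ab).apart
  wit j := by
    change (full hP n ab).w j ∈ Plane.section_ (full hP n ab).v (full hP n ab).c (P.r n) (P.h n)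
      ((full hP n ab).t j) P.S ((full hP n ab).σ j)
    rw [full_v]
    simp only [full, Plane.section_, Set.mem_setOf_eq, i0, coords_pt]
    have hℓ : 89 / 100 * P.r n / P.S = P.ℓ n := rfl
    simp only [hℓ, x0, Nat.cast_zero, zero_add, one_mul, zero_mul, sub_zero]
    have := Params.ℓ_pos hP n
    have hh := P.h_pos n
    obtain ⟨⟨h1, h2⟩, -⟩ := wy_spec hP hn ab j
    refine ⟨by linarith, by linarith, by linarith, by linarith⟩

/-- The standard certificate is well formed. [folklore] -/
theorem stdCert_wf (hP : P.Good) : (stdCert hP).WF where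
  frame n F hF := by
    obtain ⟨hn, ab, rfl⟩ := mem_stdCert.mp hF
    exact full_wf hP hn ab
  sep n F hF F' hF' hne := by
    obtain ⟨-, ab, rfl⟩ := mem_stdCert.mp hF
    obtain ⟨-, ab', rfl⟩ := mem_stdCert.mp hF'
    have hab : ab ≠ ab' := fun h => hne (by rw [h])
    have := norm_ctr_sub_ctr (P := P) n hab
    change P.r n / 2 ≤ ‖ctr n ab - ctr n ab'‖
    linarith [P.r_pos n]

/-- The standard certificate is dense. [cite: Hochman2025, Lemma 5.8] -/
theorem stdCert_dense (hP : P.Good) : (stdCert hP).Dense := by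
  intro n hn p
  obtain ⟨ab, hab⟩ := exists_ctr_near (P := P) n p
  exact ⟨full hP n ab, mem_stdCert.mpr ⟨by omega, ab, rfl⟩, hab⟩

/-- The obstacle families of the standard certificate are those of the skeleton. [folklore] -/
theorem familySet_stdCert {hP : P.Good} {n : ℕ} (ab : ℤ × ℤ) (j : Fin (P.N n)) :
    (stdCert hP).familySet (full hP n ab) j = (skelCert hP).familySet (skel hP n ab) j := by
  refine Cert.familySet_congr (fun k G₀ hG₀ => ?_) (fun k G₁ hG₁ => ?_) (sameGeom_skel_full n ab) j
  · obtain ⟨hk, ab', rfl⟩ := mem_skelCert.mp hG₀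
    exact ⟨full hP k ab', mem_stdCert.mpr ⟨hk, ab', rfl⟩, sameGeom_skel_full k ab'⟩
  · obtain ⟨hk, ab', rfl⟩ := mem_stdCert.mp hG₁
    exact ⟨skel hP k ab', mem_skelCert.mpr ⟨hk, ab', rfl⟩, sameGeom_skel_full k ab'⟩

/-- **The standard certificate is valid.** [cite: Hochman2025, Lemma 5.8] -/
theorem stdCert_valid (hP : P.Good) : (stdCert hP).Valid hP where
  wf := stdCert_wf hP
  safe := by
    intro n hn F hF j 𝔉 h𝔉
    obtain ⟨hn0, ab, rfl⟩ := mem_stdCert.mp hF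
    rw [familySet_stdCert, ← coe_fam hP hn0 ab j, Finset.coe_inj] at h𝔉
    subst h𝔉
    have := (wy_spec hP hn0 ab j).2
    have hφ : (full hP n ab).φ ((full hP n ab).w j) = (x0 (P := P) n, wy hP n ab j) := by
      simp only [Frame.φ, full_v]
      exact coords_pt _ _ _
    rw [hφ]
    exact this

end Std


namespace Params

variable {P : Params}

/-- Heights are monotone from level `1` on. [folklore] -/
theorem h_one_le (hP : P.Good) {n : ℕ} (hn : 1 ≤ n) : P.h 1 ≤ P.h n := by
  induction n with
  | zero => omega
  | succ m ih =>
    rcases Nat.lt_or_ge m 1 with hm | hm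
    · obtain rfl : m = 0 := by omega
      exact le_rfl
    · have h1 := ih hm
      have h2 := hP.r_le_h m
      have h3 := h_le_r hP hm
      linarith [P.h_pos m]

end Params

namespace Std

/-! ### The compatible configuration -/


/-- Index of a standard witness: level `m + 1`, lattice point, box. [folklore] -/
abbrev WIdx (P : Params) := Σ m : ℕ, (ℤ × ℤ) × Fin (P.N (m + 1))

/-- The standard witnesses. [folklore] -/
def W (hP : P.Good) (q : WIdx P) : ℂ := (full hP (q.1 + 1) q.2.1).w q.2.2


/-- `full` is injective in the lattice index. [folklore] -/
theorem full_injective {hP : P.Good} (n : ℕ) : Function.Injective (full hP n) := by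
  intro ab ab' h
  by_contra hne
  have := norm_ctr_sub_ctr (P := P) n hne
  have hc : (full hP n ab).c = (full hP n ab').c := by rw [h]
  change ctr n ab = ctr n ab' at hc
  rw [hc, sub_self, norm_zero] at this
  linarith [P.r_pos n]

/-- Points with the same site are at distance `< 2`. [folklore] -/
theorem norm_sub_lt_two_of_site_eq {w w' : ℂ} (h : Plane.site w = Plane.site w') : ‖w - w'‖ < 2 := by
  simp only [Plane.site, Prod.mk.injEq] at h
  obtain ⟨h1, h2⟩ := h
  have a1 := Int.floor_le w.re; have a2 := Int.lt_floor_add_one w.re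
  have b1 := Int.floor_le w'.re; have b2 := Int.lt_floor_add_one w'.re
  have c1 := Int.floor_le w.im; have c2 := Int.lt_floor_add_one w.im
  have d1 := Int.floor_le w'.im; have d2 := Int.lt_floor_add_one w'.im
  rw [h1] at a1 a2
  rw [h2] at c1 c2
  have hre : |(w - w').re| < 1 := by
    rw [Complex.sub_re, abs_lt]; constructor <;> linarith
  have him : |(w - w').im| < 1 := by
    rw [Complex.sub_im, abs_lt]; constructor <;> linarith
  have := Complex.norm_le_abs_re_add_abs_im (w - w')
  linarith

/-- **Distinct standard witnesses occupy distinct sites** (Cor. 5.3: they are `≥ h₁/2 ≥ 4`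
apart). [cite: Hochman2025, Cor 5.3] -/
theorem W_site_injective (hP : P.Good) : Function.Injective fun q : WIdx P => Plane.site (W hP q) := by
  rintro ⟨m, ab, j⟩ ⟨m', ab', j'⟩ h
  have hlt := norm_sub_lt_two_of_site_eq h
  simp only [W] at hlt
  have hV := stdCert_valid hP
  have hmem : ∀ (m : ℕ) (ab : ℤ × ℤ), full hP (m + 1) ab ∈ (stdCert hP).frames (m + 1) :=
    fun m ab => mem_stdCert.mpr ⟨by omega, ab, rfl⟩
  have hh1 : 8 ≤ P.h 1 := hP.h_one
  by_cases hm : m = m'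
  · subst hm
    by_cases hab : ab = ab'
    · subst hab
      by_cases hj : j = j'
      · subst hj; rfl
      · exfalso
        have := Cert.cor_5_3_same_frame hP hV.wf (hmem m ab) hj
        have hh := Params.h_one_le hP (by omega : 1 ≤ m + 1)
        linarith
    · exfalso
      have hne : full hP (m + 1) ab ≠ full hP (m + 1) ab' := fun h => hab (full_injective _ h)
      have := Cert.cor_5_3_same_level hP hV.wf (hmem m ab) (hmem m ab') hne rfl (j := j) (j' := j') rfl
      have hr := Params.h_le_r hP (by omega : 1 ≤ m + 1)
      have hh := Params.h_one_le hP (by omega : 1 ≤ m + 1)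
      linarith
  · exfalso
    rcases Nat.lt_or_gt_of_ne hm with hlt' | hlt'
    · have := Cert.lemma_5_2 hP hV (by omega) (by omega : m + 1 < m' + 1) (hmem m ab) (hmem m' ab') rfl j j' rfl
      have hh := Params.h_one_le hP (by omega : 1 ≤ m + 1)
      linarith
    · have := Cert.lemma_5_2 hP hV (by omega) (by omega : m' + 1 < m + 1) (hmem m' ab') (hmem m ab) rfl j' j rfl
      have hh := Params.h_one_le hP (by omega : 1 ≤ m' + 1)
      rw [norm_sub_rev] at this
      linarith


/-- The coin of box `j` of the standard frame `(a, b)` of level `m + 1`. [folklore] -/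
def coin (hP : P.Good) (m : ℕ) (ab : ℤ × ℤ) (j : Fin (P.N (m + 1))) : (ℤ × ℤ) × Cls P :=
  (Plane.site ((full hP (m + 1) ab).w j) - (full hP (m + 1) ab).z, (k0 hP, i0 hP))

/-- The bucket of box `j`. [folklore] -/
def bucket (hP : P.Good) (m : ℕ) (ab : ℤ × ℤ) (j : Fin (P.N (m + 1))) : Fin (P.buckets (m + 1)) :=
  bucketsEquiv P (m + 1) (label (m + 1) (coin hP m ab j))

/-- A fullest bucket holds `≥ 2^{k+1}` of the `k 2^{k+1}` coins. [folklore] -/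
theorem exists_big_bucket (hP : P.Good) (m : ℕ) (ab : ℤ × ℤ) :
    ∃ b : Fin (P.buckets (m + 1)), 2 ^ (P.buckets (m + 1) + 1) ≤
      (Finset.univ.filter fun j => bucket hP m ab j = b).card := by
  have hb : 0 < P.buckets (m + 1) := by
    unfold Params.buckets
    have hT : 0 < P.T := lt_of_lt_of_le (by norm_num) hP.T_le
    have hS : 0 < P.S := lt_of_lt_of_le (by norm_num) hP.S_le
    positivity
  haveI : Nonempty (Fin (P.buckets (m + 1))) := ⟨⟨0, hb⟩⟩
  have hcard : Fintype.card (Fin (P.buckets (m + 1))) * 2 ^ (P.buckets (m + 1) + 1) ≤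
      Fintype.card (Fin (P.N (m + 1))) := by
    rw [Fintype.card_fin, Fintype.card_fin]
    unfold Params.N
    exact le_rfl
  have := Fintype.exists_le_card_fiber_of_mul_le_card (bucket hP m ab) hcard
  simpa using this

/-- The chosen fullest bucket. [folklore] -/
def bstar (hP : P.Good) (m : ℕ) (ab : ℤ × ℤ) : Fin (P.buckets (m + 1)) := Classical.choose (exists_big_bucket hP m ab)

/-- The coins of the fullest bucket. [folklore] -/
def fiber (hP : P.Good) (m : ℕ) (ab : ℤ × ℤ) : Finset (Fin (P.N (m + 1))) :=
  Finset.univ.filter fun j => bucket hP m ab j = bstar hP m ab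

/-- The fullest bucket is big. [folklore] -/
theorem fiber_card (hP : P.Good) (m : ℕ) (ab : ℤ × ℤ) : 2 ^ (P.buckets (m + 1) + 1) ≤ (fiber hP m ab).card :=
  Classical.choose_spec (exists_big_bucket hP m ab)

/-- The heads of the fullest bucket: a subset of `2^k` of its coins. [folklore] -/
def headsSet (hP : P.Good) (m : ℕ) (ab : ℤ × ℤ) : Finset (Fin (P.N (m + 1))) :=
  Classical.choose (Finset.exists_subset_card_eq (s := fiber hP m ab) (n := 2 ^ P.buckets (m + 1))
    (le_trans (Nat.pow_le_pow_right (by norm_num) (Nat.le_succ _)) (fiber_card hP m ab)))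

/-- Properties of `headsSet`. [folklore] -/
theorem headsSet_spec (hP : P.Good) (m : ℕ) (ab : ℤ × ℤ) :
    headsSet hP m ab ⊆ fiber hP m ab ∧ (headsSet hP m ab).card = 2 ^ P.buckets (m + 1) :=
  Classical.choose_spec (Finset.exists_subset_card_eq (s := fiber hP m ab) (n := 2 ^ P.buckets (m + 1))
    (le_trans (Nat.pow_le_pow_right (by norm_num) (Nat.le_succ _)) (fiber_card hP m ab)))

/-- The prescribed orientation of the coins: heads exactly on `headsSet`. [folklore] -/
def orientation (hP : P.Good) (q : WIdx P) : Bool := decide (q.2.2 ∈ headsSet hP q.1 q.2.1)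

open Classical in
/-- **The standard configuration**: at the site of a standard witness, in every layer, the
prescribed orientation of its coin; `false` elsewhere. [cite: Hochman2025, Lemma 5.8] -/
def stdConf (hP : P.Good) : ℤ × ℤ → Cls P → Bool := fun s _ =>
  if h : ∃ q : WIdx P, Plane.site (W hP q) = s then orientation hP (Classical.choose h) else false


/-- The standard configuration at a standard witness. [folklore] -/
theorem stdConf_site (hP : P.Good) (q : WIdx P) (cl : Cls P) :
    stdConf hP (Plane.site (W hP q)) cl = orientation hP q := by
  have h : ∃ q' : WIdx P, Plane.site (W hP q') = Plane.site (W hP q) := ⟨q, rfl⟩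
  simp only [stdConf, h, dif_pos]
  congr 1
  exact W_site_injective hP (Classical.choose_spec h)

/-- `coin` is injective in the box. [folklore] -/
theorem coin_injective (hP : P.Good) (m : ℕ) (ab : ℤ × ℤ) : Function.Injective (coin hP m ab) := by
  intro j j' h
  simp only [coin, Prod.mk.injEq, sub_left_inj] at h
  have := W_site_injective hP (a₁ := ⟨m, ab, j⟩) (a₂ := ⟨m, ab, j'⟩) h.1
  simp only [Sigma.mk.injEq, heq_eq_eq, Prod.mk.injEq, true_and] at this
  exact this

/-- The coins of a standard frame. [folklore] -/
theorem coins_full {hP : P.Good} (m : ℕ) (ab : ℤ × ℤ) :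
    (full hP (m + 1) ab).coins = Finset.univ.image (coin hP m ab) := rfl

/-- **The coin-and-bucket configuration of a standard frame in the standard configuration**:
in bucket `b`, the heads are the boxes of bucket `b` in `headsSet` and the tails the others.
[cite: Hochman2025, Lemma 5.8] -/
theorem cbcF_full (hP : P.Good) (m : ℕ) (ab : ℤ × ℤ) (b : Fin (P.buckets (m + 1))) :
    ((full hP (m + 1) ab).cbcF (stdConf hP)).heads b =
        (Finset.univ.filter fun j => bucket hP m ab j = b ∧ j ∈ headsSet hP m ab).card ∧
      ((full hP (m + 1) ab).cbcF (stdConf hP)).tails b =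
        (Finset.univ.filter fun j => bucket hP m ab j = b ∧ j ∉ headsSet hP m ab).card := by
  classical
  have hval : ∀ j, stdConf hP ((coin hP m ab j).1 + (full hP (m + 1) ab).z) (coin hP m ab j).2 =
      decide (j ∈ headsSet hP m ab) := by
    intro j
    simp only [coin, sub_add_cancel]
    exact stdConf_site hP ⟨m, ab, j⟩ _
  simp only [Frame.cbcF, cbc, coins_full, Finset.filter_image,
    Finset.card_image_of_injective _ (coin_injective hP m ab)]
  constructor
  · congr 1
    ext j
    simp only [Finset.mem_filter, Finset.mem_univ, true_and, bucket, hval, decide_eq_true_eq]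
  · congr 1
    ext j
    simp only [Finset.mem_filter, Finset.mem_univ, true_and, bucket, hval, decide_eq_false_iff_not]

/-- **The standard configuration is compatible with the standard certificate**: the fullest
bucket of each frame shows `2^k` heads and `≥ 2^k` tails. [cite: Hochman2025, Lemma 5.8] -/
theorem stdCert_compat (hP : P.Good) : (stdCert hP).Compat (stdConf hP) := by
  intro m F hF
  obtain ⟨-, ab, rfl⟩ := mem_stdCert.mp hF
  obtain ⟨hsub, hcard⟩ := headsSet_spec hP m ab
  have hfib := fiber_card hP m ab
  obtain ⟨hH, hT⟩ := cbcF_full hP m ab (bstar hP m ab)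
  intro c' hc'
  refine CoinsAndBuckets.not_isOriented_of_big_bucket (bstar hP m ab) ?_ ?_ hc'
  · rw [hH]
    have : (Finset.univ.filter fun j => bucket hP m ab j = bstar hP m ab ∧ j ∈ headsSet hP m ab) =
        headsSet hP m ab := by
      ext j
      simp only [Finset.mem_filter, Finset.mem_univ, true_and, and_iff_right_iff_imp]
      intro hj
      have := hsub hj
      simpa [fiber] using this
    rw [this, hcard]
  · rw [hT]
    have : (Finset.univ.filter fun j => bucket hP m ab j = bstar hP m ab ∧ j ∉ headsSet hP m ab) =
        fiber hP m ab \ headsSet hP m ab := by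
      ext j
      simp [fiber]
    rw [this, Finset.card_sdiff_of_subset hsub, hcard]
    have : 2 ^ (P.buckets (m + 1) + 1) = 2 ^ P.buckets (m + 1) + 2 ^ P.buckets (m + 1) := by ring
    omega

end Std

/-- **Lemma 5.8 / §5.7: `X₀` is nonempty** — the standard configuration with the standard
certificate. [cite: Hochman2025, Lemma 5.8] -/
theorem X0_nonempty (hP : P.Good) : (X0 P hP).Nonempty :=
  ⟨Std.stdConf hP, Std.stdCert hP, Std.stdCert_valid hP, Std.stdCert_dense hP, Std.stdCert_compat hP⟩


/-! ### Safe paths stay inside their box (the role of the strips `B', B''`)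

§5.2: "It will be convenient to assume each witness `w(B)` lies on a polygonal path `γ ⊆ B`
which connects the two short edges of `B`, does not come within distance `h/20` of the long
edges ... Such a modification can be achieved using part (2) of Lemma 4.1": with the strips in
the family this is automatic — over the `x`-range of the box the diamonds `◇(2B')`, `◇(2B'')`
of the strips cover bands of height `0.03 h` around the long edges, so a continuous safe graph
through a point of the box stays in `(t + h/100, t + h - h/100)` over the whole `x`-range. -/

namespace Cert

variable {C : Cert P}

/-- The band of the upper strip: over the `x`-range of the box, points with
`t + h - h/100 ≤ y ≤ t + h + h/50` lie in `◇(2 B'')`. [cite: Hochman2025, §5.2–5.3 (the strips)] -/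
theorem mem_stripHi_toSet (hP : P.Good) {n : ℕ} (hn : 1 ≤ n) (F : Frame P n) (j : Fin (P.N n))
    {q : ℝ × ℝ} (hx : q.1 ∈ Icc (-(99 / 100 * P.r n)) (-(P.r n / 10)))
    (hy : F.t j + P.h n - P.h n / 100 ≤ q.2 ∧ q.2 ≤ F.t j + P.h n + P.h n / 50) :
    q ∈ (stripHi F j).toSet (P.famScales hP n) := by
  rw [SafePoints.Diamond.mem_toSet_iff]
  have hDn : (stripHi F j).n = n - 1 := rfl
  have ha : (P.famScales hP n).a (n - 1) = 2 * P.wB n := by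
    unfold Params.famScales
    rw [SafePoints.Scales.extendScales_a_of_lt _ (by omega : n - 1 < n)]
    unfold Params.famA; rw [if_neg (by omega)]
  have hb : (P.famScales hP n).b (n - 1) = 2 * (P.h n / 100) := by
    unfold Params.famScales
    rw [SafePoints.Scales.extendScales_b_of_lt _ (by omega : n - 1 < n)]
    unfold Params.famB; rw [if_neg (by omega)]
  rw [hDn, ha, hb]
  have hc1 : (stripHi F j).c.1 = -((109 / 200) * P.r n) := rfl
  have hc2 : (stripHi F j).c.2 = F.t j + P.h n + P.h n / 200 := rfl
  rw [hc1, hc2]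
  unfold Params.wB
  have hr := P.r_pos n
  have hh := P.h_pos n
  obtain ⟨hx1, hx2⟩ := hx
  have hdx : |q.1 - -(109 / 200 * P.r n)| ≤ 89 / 200 * P.r n := by
    rw [abs_le]; constructor <;> linarith
  have hdy : |q.2 - (F.t j + P.h n + P.h n / 200)| ≤ 3 / 200 * P.h n := by
    rw [abs_le]; constructor <;> linarith
  nlinarith [abs_nonneg (q.1 - -(109 / 200 * P.r n)), abs_nonneg (q.2 - (F.t j + P.h n + P.h n / 200))]

/-- The band of the lower strip. [cite: Hochman2025, §5.2–5.3 (the strips)] -/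
theorem mem_stripLo_toSet (hP : P.Good) {n : ℕ} (hn : 1 ≤ n) (F : Frame P n) (j : Fin (P.N n))
    {q : ℝ × ℝ} (hx : q.1 ∈ Icc (-(99 / 100 * P.r n)) (-(P.r n / 10)))
    (hy : F.t j - P.h n / 50 ≤ q.2 ∧ q.2 ≤ F.t j + P.h n / 100) :
    q ∈ (stripLo F j).toSet (P.famScales hP n) := by
  rw [SafePoints.Diamond.mem_toSet_iff]
  have hDn : (stripLo F j).n = n - 1 := rfl
  have ha : (P.famScales hP n).a (n - 1) = 2 * P.wB n := by
    unfold Params.famScales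
    rw [SafePoints.Scales.extendScales_a_of_lt _ (by omega : n - 1 < n)]
    unfold Params.famA; rw [if_neg (by omega)]
  have hb : (P.famScales hP n).b (n - 1) = 2 * (P.h n / 100) := by
    unfold Params.famScales
    rw [SafePoints.Scales.extendScales_b_of_lt _ (by omega : n - 1 < n)]
    unfold Params.famB; rw [if_neg (by omega)]
  rw [hDn, ha, hb]
  have hc1 : (stripLo F j).c.1 = -((109 / 200) * P.r n) := rfl
  have hc2 : (stripLo F j).c.2 = F.t j - P.h n / 200 := rfl
  rw [hc1, hc2]
  unfold Params.wB
  have hr := P.r_pos n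
  have hh := P.h_pos n
  obtain ⟨hx1, hx2⟩ := hx
  have hdx : |q.1 - -(109 / 200 * P.r n)| ≤ 89 / 200 * P.r n := by
    rw [abs_le]; constructor <;> linarith
  have hdy : |q.2 - (F.t j - P.h n / 200)| ≤ 3 / 200 * P.h n := by
    rw [abs_le]; constructor <;> linarith
  nlinarith [abs_nonneg (q.1 - -(109 / 200 * P.r n)), abs_nonneg (q.2 - (F.t j - P.h n / 200))]

/-- **A safe point of a box (over its `x`-range) is at height strictly between `t + h/100` and
`t + h - h/100`.** [cite: Hochman2025, §5.2] -/
theorem height_of_safe (hP : P.Good) {n : ℕ} (hn : 1 ≤ n) (F : Frame P n) (j : Fin (P.N n))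
    {𝔉 : Finset SafePoints.Diamond} (h𝔉 : (↑𝔉 : Set SafePoints.Diamond) = C.familySet F j)
    {q : ℝ × ℝ} (hx : q.1 ∈ Icc (-(99 / 100 * P.r n)) (-(P.r n / 10)))
    (hy : F.t j - P.h n / 50 ≤ q.2 ∧ q.2 ≤ F.t j + P.h n + P.h n / 50)
    (hsafe : q ∈ SafePoints.safe (P.famScales hP n) 𝔉) :
    F.t j + P.h n / 100 < q.2 ∧ q.2 < F.t j + P.h n - P.h n / 100 := by
  have hLo : stripLo F j ∈ 𝔉 := by
    rw [← Finset.mem_coe, h𝔉]; exact Or.inl (by simp [stripDiamonds])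
  have hHi : stripHi F j ∈ 𝔉 := by
    rw [← Finset.mem_coe, h𝔉]; exact Or.inl (by simp [stripDiamonds])
  have h1 := SafePoints.safe_inter_toSet (σ := P.famScales hP n) hLo
  have h2 := SafePoints.safe_inter_toSet (σ := P.famScales hP n) hHi
  rw [Set.eq_empty_iff_forall_notMem] at h1 h2
  constructor
  · by_contra hle
    push Not at hle
    exact h1 q ⟨hsafe, mem_stripLo_toSet hP hn F j hx ⟨hy.1, hle⟩⟩
  · by_contra hle
    push Not at hle
    exact h2 q ⟨hsafe, mem_stripHi_toSet hP hn F j hx ⟨hle, hy.2⟩⟩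

/-- **Safe paths stay inside their box**: a continuous graph all of whose points are safe, which
passes through a point of the box (height in `[t, t + h]`) at some abscissa of the box, has
height in `(t + h/100, t + h - h/100)` over the whole `x`-range of the box. (IVT: to leave it
the graph would have to cross one of the strip bands.) [cite: Hochman2025, §5.2] -/
theorem path_in_box (hP : P.Good) {n : ℕ} (hn : 1 ≤ n) (F : Frame P n) (j : Fin (P.N n))
    {𝔉 : Finset SafePoints.Diamond} (h𝔉 : (↑𝔉 : Set SafePoints.Diamond) = C.familySet F j)
    {f : ℝ → ℝ} (hf : Continuous f) (hsafe : ∀ x, (x, f x) ∈ SafePoints.safe (P.famScales hP n) 𝔉)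
    {x₀ : ℝ} (hx₀ : x₀ ∈ Icc (-(99 / 100 * P.r n)) (-(P.r n / 10)))
    (hy₀ : F.t j ≤ f x₀ ∧ f x₀ ≤ F.t j + P.h n) {x : ℝ} (hx : x ∈ Icc (-(99 / 100 * P.r n)) (-(P.r n / 10))) :
    F.t j + P.h n / 100 < f x ∧ f x < F.t j + P.h n - P.h n / 100 := by
  have hh := P.h_pos n
  -- it suffices that the height at `x` is in the wide band; then `height_of_safe` sharpens it
  suffices hwide : F.t j - P.h n / 50 ≤ f x ∧ f x ≤ F.t j + P.h n + P.h n / 50 from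
    height_of_safe hP hn F j h𝔉 hx hwide (hsafe x)
  have h0 := height_of_safe hP hn F j h𝔉 hx₀ ⟨by linarith [hy₀.1], by linarith [hy₀.2]⟩ (hsafe x₀)
  -- IVT on the segment between `x₀` and `x` (both in the `x`-range, which is convex)
  have hI : ∀ y ∈ Set.uIcc x₀ x, y ∈ Icc (-(99 / 100 * P.r n)) (-(P.r n / 10)) := by
    intro y hy
    rcases Set.mem_uIcc.mp hy with ⟨h1, h2⟩ | ⟨h1, h2⟩
    · exact ⟨le_trans hx₀.1 h1, le_trans h2 hx.2⟩
    · exact ⟨le_trans hx.1 h1, le_trans h2 hx₀.2⟩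
  by_contra hout
  rw [not_and_or, not_le, not_le] at hout
  rcases hout with hlow | hhigh
  · -- `f x` far below: cross the value `t + h/100` (inside the lower band) between `x₀` and `x`
    have hcont : ContinuousOn f (Set.uIcc x₀ x) := hf.continuousOn
    have hmem : F.t j + P.h n / 100 ∈ Set.uIcc (f x₀) (f x) := by
      rw [Set.uIcc_comm, Set.mem_uIcc]; left; constructor <;> linarith [h0.1]
    obtain ⟨y, hy, hfy⟩ := intermediate_value_uIcc hcont hmem
    have := height_of_safe hP hn F j h𝔉 (hI y hy) ⟨by rw [hfy]; linarith, by rw [hfy]; linarith⟩ (hsafe y)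
    rw [hfy] at this
    linarith [this.1]
  · have hcont : ContinuousOn f (Set.uIcc x₀ x) := hf.continuousOn
    have hmem : F.t j + P.h n - P.h n / 100 ∈ Set.uIcc (f x₀) (f x) := by
      rw [Set.mem_uIcc]; left; constructor <;> linarith [h0.2]
    obtain ⟨y, hy, hfy⟩ := intermediate_value_uIcc hcont hmem
    have := height_of_safe hP hn F j h𝔉 (hI y hy) ⟨by rw [hfy]; linarith, by rw [hfy]; linarith⟩ (hsafe y)
    rw [hfy] at this
    linarith [this.2]

end Cert

end Hochman2025

end Literature.Dynamics.SymbolicDynamics
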